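import Literature.NumberTheory.Automorphic.CompletedCohomologyHeckeAlgebraGLnHolds
import Literature.NumberTheory.Automorphic.HeckeTowerCompatibility
import HarnessLib

/-!
# Hida's ordinary completed cohomology and the ordinary big Hecke algebra of `GL_n` over a number field

Topic `NumberTheory/Automorphic`; namespace `Literature.NumberTheory.Automorphic`, grouping
sub-namespaces `BigHeckeGLn` / `BigHeckeGLn.TameLevel` (as `CompletedCohomologyHeckeAlgebraGLn`, which
this file continues).  Headline declarations: the ordinary big Hecke algebra
`OrdinaryHeckeAlgebraGLn 𝒰 = 𝕋^{S,ord}(𝒰)` and the predicate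
**`TameLevel.IsOrdinarilyPadicallyAutomorphic 𝒰 ρ`** (definition request of route
`Langlands/SkinnerWilesDefectOne`: `OrdinaryFactorisation`, `HidaControlGL2F`, the carrier of
`POrdinaryHeckeAlgebraGL2`).  Everything is CONSTRUCTED — definitions with bodies, no named fact, no
`sorry`, no existence smuggled; the level-compatibility of the `U_p`-operators is PROVED.

For a number field `K`, `n ≥ 0`, a prime `p` and an `S`-good level datum `𝒰 : TameLevel n K p`
(`CompletedCohomologyHeckeAlgebraGLn`):

* **Iwahori levels.** `valuedIwahoriSubgroup m β γ ≤ GL_m(F)` over any valued field (integral `g, g⁻¹`,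
  upper triangular modulo the ball of radius `min β γ`, diagonal `≡ 1` modulo the ball of radius `β`)
  and `iwahoriLevel n v b c = Iw_v(b, c) ≤ GL_n(K_v)` [AllenCalegariCaraianiGeeEtAl2023, §2.2.2],
  [KhareThorne2017, §6.2]: open (`isOpen_iwahoriLevel`), decreasing in `b, c`.
* **The Hida tower** `𝒰.hidaLevel r = U ∩ ⋂_{v ∣ p} (·)_v⁻¹ Iw_v(r, max r 1)` (Iwahori level at `p`,
  then `Iw_v(r,r)`: unipotent upper triangular mod `ϖ_v^r`), compact open Hecke subgroups forming
  `𝒰.hidaTower : LevelTower` — the good subgroups `K(b, c)` of [AllenCalegariCaraianiGeeEtAl2023, §5.1]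
  (`U(c,c)` of [KhareThorne2017, §6.3]) when `U` is maximal at `p` (`TameLevel.IsMaximalAbove`, e.g.
  `TameLevel.full`, `isMaximalAbove_full`).
* **Hecke elements at `p`**: `t_{v,i} = heckeElement n K v i` (whose double cosets are the `U_{v,i}`),
  the central `t_{v,n}^{±1}`, and the diamond elements `diamondElement n K v u = ι_v(diag u)`,
  `u ∈ T_n(𝒪_v)` [AllenCalegariCaraianiGeeEtAl2023, §2.2.2]; `hidaElements` collects them together with
  the spherical `t_{w,j}`, `w ∉ S`.
* **Level compatibility (theorems).** `isTowerCompatible_of_mem_hidaElements`: for `U` maximal above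
  `p`, EVERY Hida element acts compatibly with the pull-backs `H^•(X_{U(r)}) → H^•(X_{U(r')})`
  [KhareThorne2017, §6.2, Lemma 6.5 (2)] — for `U_{v,i}` (`bijOn_hidaLevel_heckeElement_of_mem`) this is
  the Iwahori factorisation across the cut `i`, `Iw = ι_v(N(𝒪_v)) · (Iw ∩ t Iw t⁻¹)`, proved in general
  rank by an explicit block elimination (`elimBlock`, `exists_unipotent_cutDiag_conj_mem`:
  `(1, -BD*; 0, 1)(A B; C D)` and its inverse have top-right blocks `B C* B`, `B* C B*`, divisible by
  `ϖ`, using only `A A⁻¹ = A⁻¹ A = 1` — no matrix inversion over `𝒪_v`); for the diamonds and the central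
  elements it is normalisation of the levels; for `t_{w,j}`, `w ∉ S`, the argument of
  `CompletedCohomologyGLHecke`.  Hence the operators `T_{w,j}, U_{v,i}, ⟨u⟩` on the completed cohomology
  of the Hida tower, `completedHidaHecke` (generic `completedHecke`).
* **Hecke algebras.** `hidaFamily g` (the diagonal family of finite-level operators, generic
  `towerHeckeFamily`), `hidaHeckeSubring 𝒰 k` / **`HidaHeckeAlgebraGLn 𝒰 = 𝕋^S(𝒰; p)`**: the closure of
  the subring of `∏_{(i,r,s)} End(H^i(X_{U(r)}, ℤ/p^s))` generated by all Hida operators — the completed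
  image of `𝕋^{S,ord} = 𝕋^S ⊗ ℤ[T_n(𝒪_{K,p})][U_{v,i}, U_{v,n}^{±1}]` [AllenCalegariCaraianiGeeEtAl2023,
  §5.1] (`𝕋^{S,univ}` of [KhareThorne2017, §6.5]); the finite-level algebras `hidaLevelSubring`.
* **Ordinary parts, existence-free.** `ordinaryPart 𝒰 k x = ⋂_{v ∣ p} ⋂_{j=1}^{n-1} ⋂_m 𝕋_x·U_{v,j}^m(H)`
  inside `H = H^i(X_{U(r)}, k/p^s)`: the largest Hecke-stable submodule on which the `U_{v,j}` are
  infinitely divisible.  When `H` is finite and the operators commute this IS `e H`,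
  `e = lim_m U_p^{m!}` (`exists_isIdempotentElem_forall_pow_factorial_eq`: Hida's idempotent exists in
  any finite monoid; `range_eq_iInf_range_pow_of_forall_pow_factorial_eq`, `iInf_ordSpan_eq_range`:
  `e H = ⋂_m U^m H`), i.e. `M_{ord}` of [KhareThorne2017, §2.4, Lemma 2.10], the maximal direct summand
  on which `U_p` is invertible [AllenCalegariCaraianiGeeEtAl2023, §5.1]; the definition needs neither.
* **`OrdinaryHeckeAlgebraGLn 𝒰 = 𝕋^{S,ord}(𝒰)`** (`ordHeckeSubring`): the closure of the subring of
  `∏ End(H^i(X_{U(r)}, ℤ/p^s)^{ord})` generated by the restricted operators — `lim 𝕋^S(K(b,c), ℤ/p^s)^{ord}`,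
  `𝕋^S(K(b,c), λ)^{ord} = im(𝕋^{S,ord} → End(RΓ^{ord}))` [AllenCalegariCaraianiGeeEtAl2023, §5.1], the
  big ordinary Hecke algebra `𝕋^S_{ord}(U)` of [KhareThorne2017, §6.5]; with the continuous restriction
  `toOrd : 𝕋^S(𝒰; p) → 𝕋^{S,ord}(𝒰)`, the elements `hidaT / ordT w j` (`T_{w,j}` resp. `U_{w,j}`),
  `hidaTInv / ordTInv`, `hidaDiamond / ordDiamond`, and the **`Λ`-structure**: the diamond
  homomorphisms `diamondHom`, `ordDiamondHom : T_n(𝒪_v) →* 𝕋` (multiplicativity of the operators of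
  normalising elements, `ArithmeticQuotient.heckeEnd_mul_of_conj`) and `groupRingToOrd :
  ℤ[T_n(𝒪_v)] →ₐ 𝕋^{S,ord}(𝒰)`.
* **Ordinary completed cohomology** `ordinaryCompletedCohomology 𝒰 k i ⊆ hidaCompletedCohomology 𝒰 k i =
  lim_t colim_r H^i(X_{U(r)}, k/p^t)`: compatible sequences whose stages lie in
  `ordinaryPartMod = ⋃_r im(H^i(X_{U(r)}, k/p^t)^{ord})` — cohomological `GL_n`-form of
  `H^i_{ord}(U)` [KhareThorne2017, §6.3].
* **Predicates.** `IsOrdAssociated x ρ` / `IsHidaAssociated x ρ` (`IsAssociatedFamily`: arithmetic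
  Frobenius, `heckeFrobPoly` — the normalisation of [KhareThorne2017, §6.5, Conj. 6.18] and
  [GeeNewton2020, Conj. 3.3.2]); **`IsOrdinarilyPadicallyAutomorphic 𝒰 ρ`**: `ρ` is associated with a
  CONTINUOUS point of `𝕋^{S,ord}(𝒰)`; `IsIwahoriPadicallyAutomorphic` (point of `𝕋^S(𝒰; p)`, no slope
  condition; implied, `IsOrdinarilyPadicallyAutomorphic.isIwahoriPadicallyAutomorphic`);
  `IsSlopeZeroAt x v` (`x(U_{v,j})^{m!} → 1`, the unit-eigenvalue form of ordinarity).

## Why the Hida tower and not the `p`-power tower of `TameLevel.tower`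

The request asked for `U_v = [U_r diag(ϖ_v,1) U_r]` on the FULL principal congruence tower
`U_r = U ∩ K(ϖ^r)`.  These operators are NOT compatible with the pull-backs: for `n = 2`,
`L = K(ϖ^r)`, `L' = K(ϖ^{r'})`, `r' > r ≥ 1`, `t = diag(ϖ,1)`, one has `L t L = ⊔_{b mod ϖ}
(1 + ϖ^r b E₁₂) t L` (`q_v` cosets) but every representative `(1 + ϖ^{r'} b E₁₂) t` of `L' t L' / L'`
lies in `t L`, so `L' t L' / L' → L t L / L` is constant and `T^{L'}(f ∘ π) = q_v · f(· t) ≠ (T^L f) ∘ π`.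
Hida theory lives on the Iwahori-type tower `Iw_v(b,c)` ([KhareThorne2017, §6.2, Lemma 6.5], [Hida,
Duke Math. J. 69 (1993)] for `GL_2`: `U_1(p^α)`), where the representatives `(1, B; 0, 1) t` do not
depend on the level; that tower is built here on the same tame datum `𝒰`, and Emerton's completed
cohomology of the full tower is related to it by the theory of ordinary parts
([AllenCalegariCaraianiGeeEtAl2023, §5.2]; [CaraianiNewton2023, §2.2, Prop. 2.2.8]), not formalised.

## Conventions, junk values

* `valuedIwahoriSubgroup m β γ` uses the radius `min β γ` below the diagonal, so `iwahoriLevel n v b c`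
  is `Iw_v(b, max b c)`; the literature's `Iw_v(b,c)` always has `c ≥ b`.  The conditions are imposed on
  `g` AND `g⁻¹` (redundant for `β < 1`, and making the subgroup axioms elementary; for `b = 0` the
  condition on `g⁻¹` is what cuts `GL_n(𝒪_v)` out of the integral matrices).
* `hidaT 𝒰 w j`, `ordT`, `hidaTInv`, `ordTInv` are `0` at the places of `S` not above `p` (only Hida
  places `IsHidaPlace` are meaningful); `hidaT w j` for `w ∣ p` is the `U`-operator `U_{w,j}`; for `j ≥ n`
  it is the operator of the central `t_{w,n}`.
* `ordinaryPart` takes ordinary parts for `U_{v,j}`, `1 ≤ j ≤ n-1` (Borel-ordinary at every `v ∣ p`,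
  `U_v = U_{v,1} ⋯ U_{v,n-1}` of [AllenCalegariCaraianiGeeEtAl2023, §5.1]); for `n ≤ 1` it is everything.
* The Hecke algebras are formed for any coefficient ring `k` (`ϖ = p`); the named algebras
  `HidaHeckeAlgebraGLn`, `OrdinaryHeckeAlgebraGLn` and the predicates use `k = ℤ` (`ℤ/p^s`-coefficients).
* The level-compatibility theorems (and only they, with `diamondHom`) assume `𝒰.IsMaximalAbove`; all
  definitions make sense for every `𝒰`.
* As for `𝕋(K^p)`, commutativity of `𝕋^S(𝒰; p)` is not built in (the `U_{v,i}` at one place commute by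
  Hida's lemma, [KhareThorne2017, §6.2, Lemma 6.5 (1)], not formalised); `ordinaryPart` is made
  Hecke-stable by construction (`ordSpan`) so that no commutativity is needed to DEFINE `𝕋^{S,ord}`.

## Not here (deliberately)

Finiteness of `H^i(X_{U(r)}, ℤ/p^s)` (Borel–Serre; it is what makes Hida's idempotent exist on the nose),
Hida's control theorem / independence of the level ([KhareThorne2017, Prop. 6.6];
[AllenCalegariCaraianiGeeEtAl2023, §5.2]) — a separate cite fact per the request —, Galois
representations for `𝕋^{S,ord}_𝔪` ([KhareThorne2017, Conj. 6.18, Rem. 6.19]; Scholze), the comparison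
`IsOrdinarilyPadicallyAutomorphic → IsPadicallyAutomorphic` (needs the Hochschild–Serre relation between
the two towers), continuity of `diamondHom` and the completed Iwasawa algebra `ℤ_p[[T_n(𝒪_{K,p})]]`,
non-trivial weights `λ`, the `P`-ordinary (parabolic) variant of [CaraianiNewton2023, §2.2], and an
instance of `POrdinaryHeckeAlgebraGL2` (which needs the Galois determinant and Hida finiteness: the
route's obligation; the intended carrier is a localisation of `OrdinaryHeckeAlgebraGLn 𝒰`).

## References

* P. B. Allen, F. Calegari, A. Caraiani, T. Gee, D. Helm, B. V. Le Hung, J. Newton, P. Scholze,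
  R. Taylor, J. A. Thorne, *Potential automorphy over CM fields*, Ann. of Math. 197 (2023), §2.2.2
  (`Iw_v(b,c)`, `U_{v,i}`, `⟨u⟩`), §5.1 (`K(b,c)`, `𝕋^{S,ord}`, `RΓ^{ord}`), §5.2 (Hida theory) — arXiv
  numbering [AllenCalegariCaraianiGeeEtAl2023].
* C. Khare, J. A. Thorne, *Potential automorphy and the Leopoldt conjecture*, Amer. J. Math. 139 (2017),
  §2.4 Lemma 2.10 (ordinary parts), §6.2 (`I_v(b,c)`, `U_v^i`, `⟨α⟩`, Lemma 6.5), §6.3 (`U(b,c)`, `Λ`,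
  `H^i_{ord}(U)`), §6.5 (`𝕋^S_{ord}(U)`, Conj. 6.18) [KhareThorne2017].
* H. Hida, *p-ordinary cohomology groups for SL(2) over number fields*, Duke Math. J. 69 (1993);
  *p-adic ordinary Hecke algebras for GL(2)*, Ann. Inst. Fourier 44 (1994) (the `GL_2` origin; not
  consulted for locators).
* A. Caraiani, J. Newton, arXiv:2301.10509, §2.2 (P-ordinary Hida theory) [CaraianiNewton2023].
* T. Gee, J. Newton, JIMJ (2020), §3.3 [GeeNewton2020]; D. Hansen, Crelle (2017), Def. 1.2.1
  [HansenUniversalEigenvarieties2017].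
-/

noncomputable section

open scoped NumberField
open IsDedekindDomain CategoryTheory Filter Topology Finset

namespace Literature.NumberTheory.Automorphic

/-! ### Hida's idempotent in a finite monoid -/

section HidaIdempotent

/-- **Hida's idempotent, finite case.** In a finite monoid the sequence `m ↦ u ^ m!` is
eventually constant and its eventual value `e` is an idempotent (`e = lim_{m → ∞} u^{m!}`):
pigeonhole gives `u^a = u^{a+q}`, `q ≥ 1`, and `q ∣ m!`, `a ≤ m!` for `m ≥ max a q`.
This is the existence half of [KhareThorne2017, Lemma 2.10] (there for `End_R(M)`, `M` a finite
module over a complete Noetherian local ring, reduced to the Artinian case). [cite: KhareThorne2017, §2.4, Lemma 2.10] -/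
theorem exists_isIdempotentElem_forall_pow_factorial_eq {M : Type*} [Monoid M] [Finite M]
    (u : M) : ∃ e : M, IsIdempotentElem e ∧ ∃ N : ℕ, ∀ m, N ≤ m → u ^ m.factorial = e := by
  obtain ⟨a, b, hab, he⟩ := Finite.exists_ne_map_eq_of_infinite (fun k : ℕ => u ^ k)
  change u ^ a = u ^ b at he
  wlog hlt : a < b generalizing a b
  · exact this b a hab.symm he.symm (lt_of_le_of_ne (not_lt.1 hlt) hab.symm)
  obtain ⟨q, rfl⟩ : ∃ q, b = a + q := ⟨b - a, (Nat.add_sub_cancel' hlt.le).symm⟩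
  have hq0 : 0 < q := by omega
  -- periodicity beyond `a`
  have hper : ∀ N, a ≤ N → ∀ j : ℕ, u ^ (N + j * q) = u ^ N := by
    intro N hN j
    induction j with
    | zero => simp
    | succ j ih =>
      obtain ⟨d, rfl⟩ : ∃ d, N = a + d := ⟨N - a, (Nat.add_sub_cancel' hN).symm⟩
      calc u ^ (a + d + (j + 1) * q) = u ^ (a + q) * u ^ (d + j * q) := by
              rw [← pow_add]; congr 1; ring
        _ = u ^ a * u ^ (d + j * q) := by rw [← he]
        _ = u ^ (a + d + j * q) := by rw [← pow_add]; congr 1; ring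
        _ = u ^ (a + d) := ih
  set N₀ := max a q with hN₀
  have hdvd : ∀ m, N₀ ≤ m → q ∣ m.factorial := fun m hm =>
    Nat.dvd_factorial hq0 ((le_max_right a q).trans hm)
  have hle : ∀ m, N₀ ≤ m → a ≤ m.factorial := fun m hm =>
    ((le_max_left a q).trans hm).trans (Nat.self_le_factorial m)
  refine ⟨u ^ N₀.factorial, ?_, N₀, fun m hm => ?_⟩
  · obtain ⟨j, hj⟩ := hdvd N₀ le_rfl
    change u ^ N₀.factorial * u ^ N₀.factorial = u ^ N₀.factorial
    rw [← pow_add]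
    rw [show N₀.factorial + N₀.factorial = N₀.factorial + j * q by rw [mul_comm, ← hj]]
    exact hper _ (hle N₀ le_rfl) j
  · have hfac : N₀.factorial ∣ m.factorial := Nat.factorial_dvd_factorial hm
    obtain ⟨j, hj⟩ : q ∣ m.factorial - N₀.factorial :=
      Nat.dvd_sub (hdvd m hm) (hdvd N₀ le_rfl)
    have hmN : N₀.factorial ≤ m.factorial := Nat.le_of_dvd (Nat.factorial_pos m) hfac
    have : m.factorial = N₀.factorial + j * q := by
      rw [mul_comm, ← hj, Nat.add_sub_cancel' hmN]
    rw [this]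
    exact hper _ (hle N₀ le_rfl) j

/-- If `u ^ m! = e` for all large `m` (e.g. `e` is Hida's idempotent of `u` acting on a finite
module), the range of `e` is the **`u`-divisible part** `⋂_m im(u^m)`: the ordinary part `e M` of
[KhareThorne2017, Lemma 2.10] is `⋂_m u^m M`. [cite: KhareThorne2017, §2.4, Lemma 2.10] -/
theorem range_eq_iInf_range_pow_of_forall_pow_factorial_eq {R M : Type*} [Semiring R]
    [AddCommMonoid M] [Module R M] {u e : Module.End R M} {N : ℕ}
    (h : ∀ m, N ≤ m → u ^ m.factorial = e) :
    LinearMap.range e = ⨅ m : ℕ, LinearMap.range (u ^ m) := by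
  refine le_antisymm (le_iInf fun m => ?_) ((iInf_le _ N.factorial).trans_eq (by rw [h N le_rfl]))
  have hm : m ≤ (max m N).factorial := (le_max_left m N).trans (Nat.self_le_factorial _)
  rw [← h (max m N) (le_max_right m N), ← Nat.add_sub_cancel' hm, pow_add, Module.End.mul_eq_comp]
  exact LinearMap.range_comp_le_range _ _

/-- **Slope-zero points kill the non-ordinary part.** If `x : R → A` is a continuous ring
homomorphism into a Hausdorff topological ring with `x(u)^{m!} → 1` (the eigenvalue of `u` is a
"`p`-adic unit"), then `x` vanishes on every `y` with `u^{m!} y → 0` — in particular on `(1 - e) R` when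
Hida's idempotent `e = lim u^{m!}` exists, so that `x` factors through the ordinary quotient `e R`
(cf. [KhareThorne2017, Lemma 2.10]: `T` is topologically nilpotent on `M_{non-ord}`).
[cite: KhareThorne2017, §2.4, Lemma 2.10] -/
theorem map_eq_zero_of_tendsto_pow_factorial {R A : Type*} [Ring R] [TopologicalSpace R] [Ring A]
    [TopologicalSpace A] [IsTopologicalRing A] [T2Space A] (x : R →+* A) (hx : Continuous x) {u : R}
    (hu : Tendsto (fun m : ℕ => x u ^ m.factorial) atTop (𝓝 1)) {y : R}
    (hy : Tendsto (fun m : ℕ => u ^ m.factorial * y) atTop (𝓝 0)) : x y = 0 := by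
  have h1 : Tendsto (fun m : ℕ => x (u ^ m.factorial * y)) atTop (𝓝 (x y)) := by
    have := hu.mul_const (x y)
    rw [one_mul] at this
    simpa only [map_mul, map_pow] using this
  have h2 : Tendsto (fun m : ℕ => x (u ^ m.factorial * y)) atTop (𝓝 0) := by
    have := (hx.tendsto 0).comp hy
    rwa [map_zero] at this
  exact tendsto_nhds_unique h1 h2

end HidaIdempotent

/-! ### Iwahori-type subgroups of `GL_m` over a valued field -/

section ValuedIwahori

variable {F Γ₀ : Type*} [Field F] [LinearOrderedCommGroupWithZero Γ₀] [Valued F Γ₀]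
  (m : Type*) [Fintype m] [DecidableEq m] [LinearOrder m]

/-- The entrywise conditions of the Iwahori-type subgroup `Iw(β, γ)` on a matrix `A`: integral
entries, entries strictly below the diagonal of valuation `≤ min β γ` ("upper triangular modulo the
ball of radius `min β γ`"), diagonal entries `≡ 1` modulo the ball of radius `β`. [folklore] -/
structure IwahoriCond (β γ : Γ₀) (A : Matrix m m F) : Prop where
  le_one : ∀ i j, Valued.v (A i j) ≤ 1
  lower : ∀ i j, j < i → Valued.v (A i j) ≤ min β γ
  diag : ∀ i, Valued.v (A i i - 1) ≤ β

variable {m}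

omit [Fintype m] in
/-- The identity matrix satisfies the Iwahori conditions. [folklore] -/
theorem iwahoriCond_one {β γ : Γ₀} : IwahoriCond m β γ (1 : Matrix m m F) := by
  refine ⟨fun i j => ?_, fun i j hij => ?_, fun i => by simp⟩
  · rw [Matrix.one_apply]; split_ifs <;> simp
  · rw [Matrix.one_apply_ne (ne_of_gt hij)]; simp

/-- The Iwahori conditions are closed under products (ultrametric inequality; the diagonal entries of
`AB - 1 = (A - 1)B + (B - 1)` are bounded using `min β γ ≤ β`). [folklore] -/
theorem IwahoriCond.mul {β γ : Γ₀} {A B : Matrix m m F} (hA : IwahoriCond m β γ A)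
    (hB : IwahoriCond m β γ B) : IwahoriCond m β γ (A * B) := by
  refine ⟨fun i j => by simpa using valued_mul_apply_le m hA.le_one hB.le_one i j,
    fun i j hij => ?_, fun i => ?_⟩
  · rw [Matrix.mul_apply]
    refine Valued.v.map_sum_le fun l _ => ?_
    rw [map_mul]
    rcases lt_or_ge l i with hl | hl
    · simpa using mul_le_mul' (hA.lower i l hl) (hB.le_one l j)
    · simpa using mul_le_mul' (hA.le_one i l) (hB.lower l j (hij.trans_le hl))
  · have hAB : (A * B) i i - 1 = ((A - 1) * B) i i + (B - 1) i i := by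
      have hmat : A * B - 1 = (A - 1) * B + (B - 1) := by
        rw [sub_mul, one_mul, sub_add_sub_cancel]
      have := congrFun (congrFun hmat i) i
      rwa [Matrix.sub_apply, Matrix.one_apply_eq, Matrix.add_apply] at this
    rw [hAB]
    refine Valued.v.map_add_le ?_ (by rw [Matrix.sub_apply, Matrix.one_apply_eq]; exact hB.diag i)
    rw [Matrix.mul_apply]
    refine Valued.v.map_sum_le fun l _ => ?_
    rw [map_mul]
    rcases lt_trichotomy l i with hl | rfl | hl
    · rw [Matrix.sub_apply, Matrix.one_apply_ne (ne_of_gt hl), sub_zero]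
      simpa using mul_le_mul' ((hA.lower i l hl).trans (min_le_left _ _)) (hB.le_one l i)
    · simpa using mul_le_mul' (hA.diag l) (hB.le_one l l)
    · rw [Matrix.sub_apply, Matrix.one_apply_ne (ne_of_lt hl), sub_zero]
      simpa using mul_le_mul' (hA.le_one i l) ((hB.lower l i hl).trans (min_le_left _ _))

variable (m)

/-- The **Iwahori-type subgroup `Iw(β, γ)` of `GL_m(F)`** over a valued field `(F, v)`: the
invertible matrices `g` such that `g` and `g⁻¹` are integral, upper triangular modulo the ball
`{x | v x ≤ min β γ}` and with diagonal entries `≡ 1` modulo the ball `{x | v x ≤ β}` (the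
conditions are imposed on `g` and on `g⁻¹`, which makes the subgroup axioms elementary for all
radii; for `β < 1` the conditions on `g⁻¹` follow from those on `g`, as `g` is then unipotent upper
triangular modulo the maximal ideal, hence invertible over `𝒪_F`).  For `F = K_v`, `β = |ϖ_v|^b`,
`γ = |ϖ_v|^c`, `c ≥ b`, this is `Iw_v(b, c)`: upper triangular mod `ϖ_v^c`, unipotent upper
triangular mod `ϖ_v^b` [cite: AllenCalegariCaraianiGeeEtAl2023, §2.2.2 (the subgroups Iw_v(b,c))];
`Iw(1, |ϖ_v|)` is the standard Iwahori subgroup and `Iw(1, 1) = GL_m(𝒪_F)`. -/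
def valuedIwahoriSubgroup (β γ : Γ₀) : Subgroup (GL m F) where
  carrier := {g | IwahoriCond m β γ (g : Matrix m m F) ∧ IwahoriCond m β γ ((g⁻¹ : GL m F) : Matrix m m F)}
  one_mem' := ⟨by simpa using iwahoriCond_one, by simpa using iwahoriCond_one⟩
  mul_mem' := by
    rintro g h ⟨hg₁, hg₂⟩ ⟨hh₁, hh₂⟩
    refine ⟨by simpa using hg₁.mul hh₁, ?_⟩
    rw [mul_inv_rev]
    simpa using hh₂.mul hg₂
  inv_mem' := by
    rintro g ⟨hg₁, hg₂⟩
    exact ⟨hg₂, by simpa using hg₁⟩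

variable {m}

/-- Membership in `Iw(β, γ)` (definitional). [folklore] -/
theorem mem_valuedIwahoriSubgroup_iff {β γ : Γ₀} {g : GL m F} :
    g ∈ valuedIwahoriSubgroup m β γ ↔
      IwahoriCond m β γ (g : Matrix m m F) ∧ IwahoriCond m β γ ((g⁻¹ : GL m F) : Matrix m m F) :=
  Iff.rfl

omit [Fintype m] [DecidableEq m] in
/-- The Iwahori conditions weaken as the radii grow. [folklore] -/
theorem IwahoriCond.anti {β β' γ γ' : Γ₀} (hβ : β' ≤ β) (hγ : γ' ≤ γ) {A : Matrix m m F}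
    (h : IwahoriCond m β' γ' A) : IwahoriCond m β γ A :=
  ⟨h.le_one, fun i j hij => (h.lower i j hij).trans (min_le_min hβ hγ), fun i => (h.diag i).trans hβ⟩

/-- `Iw(β', γ') ≤ Iw(β, γ)` for `β' ≤ β`, `γ' ≤ γ`. [folklore] -/
theorem valuedIwahoriSubgroup_antitone {β β' γ γ' : Γ₀} (hβ : β' ≤ β) (hγ : γ' ≤ γ) :
    valuedIwahoriSubgroup (F := F) m β' γ' ≤ valuedIwahoriSubgroup m β γ :=
  fun _ hg => ⟨hg.1.anti hβ hγ, hg.2.anti hβ hγ⟩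

/-- `Iw(β, γ) ≤ GL_m(𝒪_F)` (the valued congruence subgroup of radius `1`). [folklore] -/
theorem valuedIwahoriSubgroup_le_valuedCongruenceSubgroup_one {β γ : Γ₀} :
    valuedIwahoriSubgroup (F := F) m β γ ≤ valuedCongruenceSubgroup m (1 : Γ₀) := by
  rintro g ⟨hg₁, hg₂⟩
  refine (mem_valuedCongruenceSubgroup_iff (m := m)).2 ⟨hg₁.le_one, hg₂.le_one, fun i j => ?_⟩
  rw [Matrix.sub_apply]
  refine (Valued.v.map_sub _ _).trans (max_le (hg₁.le_one i j) ?_)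
  rw [Matrix.one_apply]; split_ifs <;> simp

end ValuedIwahori

/-! ### Block elimination across a cut `{j < i} ⊔ {j ≥ i}` (pure algebra) -/

section Elimination

variable {R : Type*} [CommRing R] {n : ℕ}

/-- The correction block of the elimination: `E_{jk} = ∑_{q ≥ i} A_{jq} A'_{qk}` for `j < i ≤ k`
and `0` elsewhere (for `A' = A⁻¹` in block form `A = (A₁ B; C D)`, `A⁻¹ = (A* B*; C* D*)` this is
the top-right block `B D*`). [folklore] -/
def elimBlock (i : ℕ) (A A' : Matrix (Fin n) (Fin n) R) : Matrix (Fin n) (Fin n) R :=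
  fun j k => if j.val < i ∧ ¬k.val < i then ∑ q ∈ univ with ¬q.val < i, A j q * A' q k else 0

/-- `E` vanishes outside the top-right block. [folklore] -/
theorem elimBlock_apply_of_not {i : ℕ} {A A' : Matrix (Fin n) (Fin n) R} {j k : Fin n}
    (h : ¬(j.val < i ∧ ¬k.val < i)) : elimBlock i A A' j k = 0 := if_neg h

/-- `E² = 0` (`E` maps the `≥ i` block to the `< i` block). [folklore] -/
theorem elimBlock_mul_elimBlock (i : ℕ) (A A' : Matrix (Fin n) (Fin n) R) :
    elimBlock i A A' * elimBlock i A A' = 0 := by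
  ext j k
  rw [Matrix.mul_apply, Matrix.zero_apply]
  refine sum_eq_zero fun s _ => ?_
  by_cases hs : s.val < i
  · rw [elimBlock_apply_of_not (j := j) (k := s) (fun h => h.2 hs), zero_mul]
  · rw [elimBlock_apply_of_not (j := s) (k := k) (fun h => hs h.1), mul_zero]

/-- The unipotent element `u = 1 + E` of `GL_n` attached to a square-zero matrix `E`, with inverse
`1 - E`. [folklore] -/
def unipotentOfSqZero (E : Matrix (Fin n) (Fin n) R) (hE : E * E = 0) : GL (Fin n) R where
  val := 1 + E
  inv := 1 - E
  val_inv := by rw [add_mul, mul_sub, mul_sub, one_mul, mul_one, one_mul, hE]; abel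
  inv_val := by rw [sub_mul, mul_add, mul_add, one_mul, mul_one, one_mul, hE]; abel

/-- The matrix of `unipotentOfSqZero E` is `1 + E`. [folklore] -/
@[simp] theorem coe_unipotentOfSqZero (E : Matrix (Fin n) (Fin n) R) (hE : E * E = 0) :
    (unipotentOfSqZero E hE : Matrix (Fin n) (Fin n) R) = 1 + E := rfl

/-- The matrix of `(unipotentOfSqZero E)⁻¹` is `1 - E`. [folklore] -/
@[simp] theorem coe_unipotentOfSqZero_inv (E : Matrix (Fin n) (Fin n) R) (hE : E * E = 0) :
    ((unipotentOfSqZero E hE)⁻¹ : GL (Fin n) R) = (1 - E : Matrix (Fin n) (Fin n) R) := rfl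

/-- A row sum of `A' * A = 1` split along the cut. [folklore] -/
theorem sum_filter_not_mul_eq {i : ℕ} {A A' : Matrix (Fin n) (Fin n) R} (h : A' * A = 1)
    (q k : Fin n) :
    ∑ s ∈ univ with ¬s.val < i, A' q s * A s k =
      (1 : Matrix (Fin n) (Fin n) R) q k - ∑ s ∈ univ with s.val < i, A' q s * A s k := by
  rw [eq_sub_iff_add_eq', sum_filter_add_sum_filter_not, ← Matrix.mul_apply, h]

/-- **Block elimination, first identity.** For `A' A = 1` and `j < i ≤ k`, the `(j,k)` entry of
`(1 - E) A` is `∑_{q ≥ i} ∑_{s < i} A_{jq} A'_{qs} A_{sk}` — in block form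
`(1, -BD*; 0, 1)(A₁ B; C D)` has top-right block `B - B D* D = B C* B`. [folklore] -/
theorem one_sub_elimBlock_mul_apply {i : ℕ} {A A' : Matrix (Fin n) (Fin n) R} (h : A' * A = 1)
    {j k : Fin n} (hj : j.val < i) (hk : ¬k.val < i) :
    ((1 - elimBlock i A A') * A) j k =
      ∑ q ∈ univ with ¬q.val < i, ∑ s ∈ univ with s.val < i, A j q * (A' q s * A s k) := by
  have hE : ∀ s, elimBlock i A A' j s * A s k =
      if ¬s.val < i then (∑ q ∈ univ with ¬q.val < i, A j q * A' q s) * A s k else 0 := by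
    intro s
    unfold elimBlock
    split_ifs with h1 h2 h2 <;> simp_all
  rw [Matrix.sub_mul, Matrix.one_mul, Matrix.sub_apply, Matrix.mul_apply]
  simp_rw [hE]
  rw [← sum_filter]
  simp_rw [sum_mul]
  rw [sum_comm]
  simp_rw [mul_assoc, ← mul_sum, sum_filter_not_mul_eq h, mul_sub, sum_sub_distrib, Matrix.one_apply,
    mul_ite, mul_one, mul_zero, sum_ite_eq']
  have hkQ : k ∈ univ.filter fun q : Fin n => ¬q.val < i := mem_filter.2 ⟨mem_univ _, hk⟩
  rw [if_pos hkQ, sub_sub_cancel]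

/-- Rows `j ≥ i` of `(1 - E) A` are those of `A`. [folklore] -/
theorem one_sub_elimBlock_mul_apply_of_not {i : ℕ} (A A' : Matrix (Fin n) (Fin n) R)
    {j : Fin n} (hj : ¬j.val < i) (k : Fin n) :
    ((1 - elimBlock i A A') * A) j k = A j k := by
  rw [Matrix.sub_mul, Matrix.one_mul, Matrix.sub_apply, Matrix.mul_apply, sub_eq_self]
  exact sum_eq_zero fun s _ => by rw [elimBlock_apply_of_not (fun h => hj h.1), zero_mul]

/-- **Block elimination, second identity.** For `A A' = 1 = A' A` and `j < i ≤ k`, the `(j,k)`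
entry of `A' (1 + E)` is `∑_{q ≥ i} ∑_{s < i} A'_{jq} A_{qs} A'_{sk}` — in block form the top-right
block of `A⁻¹ (1, BD*; 0, 1)` is `A* B D* + B* = B* C B*`. [folklore] -/
theorem mul_one_add_elimBlock_apply {i : ℕ} {A A' : Matrix (Fin n) (Fin n) R} (h : A' * A = 1)
    (h' : A * A' = 1) {j k : Fin n} (hj : j.val < i) (hk : ¬k.val < i) :
    (A' * (1 + elimBlock i A A')) j k =
      ∑ q ∈ univ with ¬q.val < i, ∑ s ∈ univ with s.val < i, A' j q * (A q s * A' s k) := by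
  have hE : ∀ s, A' j s * elimBlock i A A' s k =
      if s.val < i then A' j s * ∑ q ∈ univ with ¬q.val < i, A s q * A' q k else 0 := by
    intro s
    unfold elimBlock
    split_ifs with h1 h2 h2 <;> simp_all
  rw [Matrix.mul_add, Matrix.mul_one, Matrix.add_apply, Matrix.mul_apply]
  simp_rw [hE]
  rw [← sum_filter]
  simp_rw [mul_sum, ← mul_assoc]
  rw [sum_comm]
  simp_rw [← sum_mul]
  -- `∑_{s < i} A'_{js} A_{sq} = δ_{jq} - ∑_{s ≥ i} A'_{js} A_{sq}` and `δ_{jq} = 0` for `q ≥ i`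
  have hrow : ∀ q ∈ univ.filter (fun q : Fin n => ¬q.val < i),
      (∑ s ∈ univ with s.val < i, A' j s * A s q) * A' q k =
        -((∑ s ∈ univ with ¬s.val < i, A' j s * A s q) * A' q k) := by
    intro q hq
    rw [mem_filter] at hq
    have hjq : j ≠ q := fun e => hq.2 (e ▸ hj)
    rw [← neg_mul, neg_eq_iff_eq_neg.2]
    rw [eq_neg_iff_add_eq_zero, add_comm, sum_filter_add_sum_filter_not, ← Matrix.mul_apply, h,
      Matrix.one_apply_ne hjq]
  rw [sum_congr rfl hrow, sum_neg_distrib]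
  simp_rw [sum_mul]
  rw [sum_comm]
  simp_rw [mul_assoc, ← mul_sum]
  have hcol : ∀ s : Fin n, ∑ q ∈ univ with ¬q.val < i, A s q * A' q k =
      (1 : Matrix (Fin n) (Fin n) R) s k - ∑ q ∈ univ with q.val < i, A s q * A' q k := by
    intro s
    rw [eq_sub_iff_add_eq', sum_filter_add_sum_filter_not, ← Matrix.mul_apply, h']
  simp_rw [hcol, mul_sub, sum_sub_distrib, Matrix.one_apply, mul_ite, mul_one, mul_zero, sum_ite_eq']
  have hkQ : k ∈ univ.filter fun q : Fin n => ¬q.val < i := mem_filter.2 ⟨mem_univ _, hk⟩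
  rw [if_pos hkQ]
  ring

end Elimination

/-! ### Conjugation by the cut torus element and the Iwahori factorisation across a cut -/

section CutTorus

variable {F Γ₀ : Type*} [Field F] [LinearOrderedCommGroupWithZero Γ₀] [Valued F Γ₀] {n : ℕ}

/-- The **cut torus element** `t = diag(ϖ, …, ϖ, 1, …, 1) ∈ GL_n(F)` (`ϖ` in the first `i`
slots), the local shape of the Hecke elements `t_{v,i}` (`heckeElement_eq_ofLocal`). [folklore] -/
def cutDiag (ϖ : Fˣ) (i : ℕ) : GL (Fin n) F :=
  glDiagonal n F fun k => if k.val < i then ϖ else 1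

omit [LinearOrderedCommGroupWithZero Γ₀] [Valued F Γ₀] in
/-- Entries of `t⁻¹ x t`: `(t⁻¹ x t)_{jk} = d_j⁻¹ x_{jk} d_k`, `d = (ϖ,…,ϖ,1,…,1)`. [folklore] -/
theorem coe_cutDiag_inv_mul_mul_apply (ϖ : Fˣ) (i : ℕ) (x : GL (Fin n) F) (j k : Fin n) :
    (((cutDiag ϖ i)⁻¹ * x * cutDiag ϖ i : GL (Fin n) F) : Matrix (Fin n) (Fin n) F) j k =
      ((if j.val < i then ϖ else 1 : Fˣ)⁻¹ : Fˣ) * (x : Matrix (Fin n) (Fin n) F) j k *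
        ((if k.val < i then ϖ else 1 : Fˣ) : F) := by
  rw [cutDiag, ← map_inv, Units.val_mul, Units.val_mul, coe_glDiagonal, coe_glDiagonal,
    Matrix.mul_diagonal, Matrix.diagonal_mul, Pi.inv_apply]

/-- `x` has its **top-right block divisible by `ϖ`** across the cut at `i`:
`v(x_{jk}) ≤ v(ϖ)` for `j < i ≤ k`. [folklore] -/
def TopRightDivisible (ϖ : Fˣ) (i : ℕ) (A : Matrix (Fin n) (Fin n) F) : Prop :=
  ∀ j k : Fin n, j.val < i → ¬k.val < i → Valued.v (A j k) ≤ Valued.v (ϖ : F)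

/-- Valuations of the entries of `t⁻¹ x t`. [folklore] -/
theorem valued_cutDiag_inv_mul_mul_apply (ϖ : Fˣ) (i : ℕ) (x : GL (Fin n) F) (j k : Fin n) :
    Valued.v ((((cutDiag ϖ i)⁻¹ * x * cutDiag ϖ i : GL (Fin n) F) : Matrix (Fin n) (Fin n) F) j k) =
      (if j.val < i then (Valued.v (ϖ : F))⁻¹ else 1) * Valued.v ((x : Matrix (Fin n) (Fin n) F) j k) *
        (if k.val < i then Valued.v (ϖ : F) else 1) := by
  rw [coe_cutDiag_inv_mul_mul_apply, map_mul, map_mul]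
  congr 1
  · congr 1
    split_ifs
    · rw [Units.val_inv_eq_inv_val, map_inv₀]
    · simp
  · split_ifs <;> simp

/-- **Conjugation by `t` preserves the Iwahori conditions on matrices whose top-right block is
divisible by `ϖ`** (for `v(ϖ) ≤ 1`): the bottom-left block is multiplied by `ϖ`, the top-right one
divided by `ϖ`, the diagonal blocks are unchanged. [folklore] -/
theorem IwahoriCond.cutDiag_conj {β γ : Γ₀} {ϖ : Fˣ} (hϖ : Valued.v (ϖ : F) ≤ 1) {i : ℕ}
    {x : GL (Fin n) F} (hx : IwahoriCond (Fin n) β γ (x : Matrix (Fin n) (Fin n) F))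
    (hdiv : TopRightDivisible ϖ i (x : Matrix (Fin n) (Fin n) F)) :
    IwahoriCond (Fin n) β γ
      (((cutDiag ϖ i)⁻¹ * x * cutDiag ϖ i : GL (Fin n) F) : Matrix (Fin n) (Fin n) F) := by
  have hπ0 : 0 < Valued.v (ϖ : F) := zero_lt_iff.2 ((Valuation.ne_zero_iff _).2 ϖ.ne_zero)
  have key : ∀ j k : Fin n, Valued.v ((((cutDiag ϖ i)⁻¹ * x * cutDiag ϖ i : GL (Fin n) F) :
      Matrix (Fin n) (Fin n) F) j k) ≤ Valued.v ((x : Matrix (Fin n) (Fin n) F) j k) ∨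
      (j.val < i ∧ ¬k.val < i) := by
    intro j k
    rw [valued_cutDiag_inv_mul_mul_apply]
    split_ifs with hj hk hk
    · left
      rw [mul_comm, ← mul_assoc, mul_inv_cancel₀ hπ0.ne', one_mul]
    · exact Or.inr ⟨hj, hk⟩
    · left
      rw [one_mul]
      exact (mul_le_mul_right hϖ _).trans_eq (mul_one _)
    · left
      rw [one_mul, mul_one]
  refine ⟨fun j k => ?_, fun j k hkj => ?_, fun j => ?_⟩
  · rcases key j k with h | ⟨hj, hk⟩
    · exact h.trans (hx.le_one j k)
    · rw [valued_cutDiag_inv_mul_mul_apply, if_pos hj, if_neg hk, mul_one]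
      exact (inv_mul_le_one₀ hπ0).2 (hdiv j k hj hk)
  · rcases key j k with h | ⟨hj, hk⟩
    · exact h.trans (hx.lower j k hkj)
    · exact absurd (lt_trans (Fin.lt_def.1 hkj) hj) hk
  · have : (((cutDiag ϖ i)⁻¹ * x * cutDiag ϖ i : GL (Fin n) F) : Matrix (Fin n) (Fin n) F) j j =
        (x : Matrix (Fin n) (Fin n) F) j j := by
      rw [coe_cutDiag_inv_mul_mul_apply]
      split_ifs
      · rw [mul_comm, ← mul_assoc, Units.mul_inv, one_mul]
      · simp
    rw [this]
    exact hx.diag j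

/-- Conversely, if `t⁻¹ x t` is integral then the top-right block of `x` is divisible by `ϖ`.
[folklore] -/
theorem topRightDivisible_of_le_one {ϖ : Fˣ} {i : ℕ} {x : GL (Fin n) F}
    (h : ∀ j k : Fin n, Valued.v ((((cutDiag ϖ i)⁻¹ * x * cutDiag ϖ i : GL (Fin n) F) :
      Matrix (Fin n) (Fin n) F) j k) ≤ 1) :
    TopRightDivisible ϖ i (x : Matrix (Fin n) (Fin n) F) := by
  have hπ0 : 0 < Valued.v (ϖ : F) := zero_lt_iff.2 ((Valuation.ne_zero_iff _).2 ϖ.ne_zero)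
  intro j k hj hk
  have := h j k
  rw [valued_cutDiag_inv_mul_mul_apply, if_pos hj, if_neg hk, mul_one] at this
  exact (inv_mul_le_one₀ hπ0).1 this

/-- The elimination element `u = 1 + E` satisfies every Iwahori condition (it is unipotent upper
triangular with integral entries when `A`, `A'` are integral). [folklore] -/
theorem iwahoriCond_one_add_elimBlock {β γ : Γ₀} {i : ℕ} {A A' : Matrix (Fin n) (Fin n) F}
    (hA : ∀ j k, Valued.v (A j k) ≤ 1) (hA' : ∀ j k, Valued.v (A' j k) ≤ 1) (ε : F)
    (hε : ε = 1 ∨ ε = -1) :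
    IwahoriCond (Fin n) β γ (1 + ε • elimBlock i A A') := by
  have hE : ∀ j k, Valued.v (elimBlock i A A' j k) ≤ 1 := by
    intro j k
    unfold elimBlock
    split_ifs
    · refine Valued.v.map_sum_le fun q _ => ?_
      rw [map_mul]
      simpa using mul_le_mul' (hA j q) (hA' q k)
    · simp
  have hεv : Valued.v ε = 1 := by rcases hε with rfl | rfl <;> simp
  refine ⟨fun j k => ?_, fun j k hkj => ?_, fun j => ?_⟩
  · rw [Matrix.add_apply, Matrix.smul_apply, smul_eq_mul]
    refine (Valued.v.map_add _ _).trans (max_le ?_ ?_)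
    · rw [Matrix.one_apply]; split_ifs <;> simp
    · rw [map_mul, hεv, one_mul]; exact hE j k
  · rw [Matrix.add_apply, Matrix.smul_apply, smul_eq_mul, Matrix.one_apply_ne (ne_of_gt hkj),
      elimBlock_apply_of_not (fun h => h.2 (lt_trans (Fin.lt_def.1 hkj) h.1)), mul_zero, add_zero,
      map_zero]
    exact zero_le
  · rw [Matrix.add_apply, Matrix.smul_apply, smul_eq_mul, Matrix.one_apply_eq,
      elimBlock_apply_of_not (fun h => h.2 h.1), mul_zero, add_zero, sub_self, map_zero]
    exact zero_le

/-- **Iwahori factorisation across the cut.** For `l ∈ Iw(β, γ)` with `min β γ ≤ v(ϖ) ≤ 1` there is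
a unipotent `u ∈ ⋂_{β',γ'} Iw(β', γ')` (namely `u = (1, B D*; 0, 1)` in block form) such that
`t⁻¹ (u⁻¹ l) t ∈ Iw(β, γ)` for the cut torus element `t = diag(ϖ^{(i)}, 1^{(n-i)})`: the block
elimination `u⁻¹ l = (A₁ - BD*C, BC*B; C, D)` has top-right block divisible by `ϖ`, and so has its
inverse. This is the group-theoretic input `Iw = N(𝒪) · (Iw ∩ t Iw t⁻¹)` for the level-compatibility
of the operators `U_{v,i}` [cite: KhareThorne2017, §6.2, Lemma 6.5 (2)]. -/
theorem exists_unipotent_cutDiag_conj_mem {β γ : Γ₀} {ϖ : Fˣ} (hϖ : Valued.v (ϖ : F) ≤ 1)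
    (hγ : min β γ ≤ Valued.v (ϖ : F)) (i : ℕ) {l : GL (Fin n) F}
    (hl : l ∈ valuedIwahoriSubgroup (Fin n) β γ) :
    ∃ u : GL (Fin n) F, (∀ β' γ' : Γ₀, u ∈ valuedIwahoriSubgroup (Fin n) β' γ') ∧
      (cutDiag ϖ i)⁻¹ * (u⁻¹ * l) * cutDiag ϖ i ∈ valuedIwahoriSubgroup (Fin n) β γ := by
  set A : Matrix (Fin n) (Fin n) F := l.val with hA
  set A' : Matrix (Fin n) (Fin n) F := (l⁻¹ : GL (Fin n) F).val with hA'
  have hAA' : A * A' = 1 := l.mul_inv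
  have hA'A : A' * A = 1 := l.inv_mul
  set u := unipotentOfSqZero (elimBlock i A A') (elimBlock_mul_elimBlock i A A') with hu
  have hu_mem : ∀ β' γ' : Γ₀, u ∈ valuedIwahoriSubgroup (Fin n) β' γ' := fun β' γ' => by
    refine ⟨?_, ?_⟩
    · rw [hu, coe_unipotentOfSqZero]
      have h1 := iwahoriCond_one_add_elimBlock (β := β') (γ := γ') (i := i) hl.1.le_one
        hl.2.le_one 1 (Or.inl rfl)
      rwa [one_smul] at h1
    · have : ((u⁻¹ : GL (Fin n) F) : Matrix (Fin n) (Fin n) F) =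
          1 + (-1 : F) • elimBlock i A A' := by
        rw [hu, coe_unipotentOfSqZero_inv, neg_one_smul, sub_eq_add_neg]
      rw [this]
      exact iwahoriCond_one_add_elimBlock hl.1.le_one hl.2.le_one (-1) (Or.inr rfl)
  refine ⟨u, hu_mem, ?_⟩
  -- `m = u⁻¹ l ∈ Iw(β, γ)` with top-right blocks of `m`, `m⁻¹` divisible by `ϖ`
  have hm : u⁻¹ * l ∈ valuedIwahoriSubgroup (Fin n) β γ := mul_mem (inv_mem (hu_mem β γ)) hl
  have hdiv : TopRightDivisible ϖ i ((u⁻¹ * l : GL (Fin n) F) : Matrix (Fin n) (Fin n) F) := by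
    intro j k hj hk
    rw [Units.val_mul, hu, coe_unipotentOfSqZero_inv, ← hA, one_sub_elimBlock_mul_apply hA'A hj hk]
    refine (Valued.v.map_sum_le fun q hq => Valued.v.map_sum_le fun s hs => ?_).trans hγ
    rw [mem_filter] at hq hs
    rw [map_mul, map_mul]
    have h1 := hl.1.le_one j q
    have h2 := hl.2.lower q s (Fin.lt_def.2 (lt_of_lt_of_le hs.2 (not_lt.1 hq.2)))
    have h3 := hl.1.le_one s k
    calc Valued.v (A j q) * (Valued.v (A' q s) * Valued.v (A s k)) ≤ 1 * (min β γ * 1) :=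
          mul_le_mul' h1 (mul_le_mul' h2 h3)
      _ = min β γ := by rw [one_mul, mul_one]
  have hdiv' : TopRightDivisible ϖ i (((u⁻¹ * l)⁻¹ : GL (Fin n) F) : Matrix (Fin n) (Fin n) F) := by
    intro j k hj hk
    rw [mul_inv_rev, inv_inv, Units.val_mul, hu, coe_unipotentOfSqZero, ← hA',
      mul_one_add_elimBlock_apply hA'A hAA' hj hk]
    refine (Valued.v.map_sum_le fun q hq => Valued.v.map_sum_le fun s hs => ?_).trans hγ
    rw [mem_filter] at hq hs
    rw [map_mul, map_mul]
    have h1 := hl.2.le_one j q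
    have h2 := hl.1.lower q s (Fin.lt_def.2 (lt_of_lt_of_le hs.2 (not_lt.1 hq.2)))
    have h3 := hl.2.le_one s k
    calc Valued.v (A' j q) * (Valued.v (A q s) * Valued.v (A' s k)) ≤ 1 * (min β γ * 1) :=
          mul_le_mul' h1 (mul_le_mul' h2 h3)
      _ = min β γ := by rw [one_mul, mul_one]
  refine ⟨hm.1.cutDiag_conj hϖ hdiv, ?_⟩
  have : ((cutDiag ϖ i)⁻¹ * (u⁻¹ * l) * cutDiag ϖ i)⁻¹ =
      (cutDiag ϖ i)⁻¹ * (u⁻¹ * l)⁻¹ * cutDiag ϖ i := by group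
  rw [this]
  exact hm.2.cutDiag_conj hϖ hdiv'

end CutTorus

/-! ### The Iwahori levels `Iw_v(b,c)` at a finite place and the Hida tower of a tame level -/

namespace BigHeckeGLn

variable {n : ℕ} {K : Type} [Field K] [NumberField K]

/-- The valuation of the fixed uniformiser `ϖ_v` is `|ϖ_v| = exp(-1)` (this is
`BigHeckeGLn.valued_uniformizerAt` of `CuspidalCohomologyGLRankOneCharacter`, a file outside the
import cone of this vocabulary file; re-derived privately in three lines). [folklore] -/
private theorem valued_uniformizerAt_aux (v : HeightOneSpectrum (𝓞 K)) :
    Valued.v ((uniformizerAt v : (v.adicCompletion K)ˣ) : v.adicCompletion K) =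
      WithZero.exp (-1 : ℤ) := by
  unfold uniformizerAt
  rw [Units.val_mk0]
  exact (HeightOneSpectrum.valuedAdicCompletion_eq_valuation' v _).trans
    (Classical.choose_spec (v.valuation_exists_uniformizer K))

variable (n) in
/-- **The Iwahori level `Iw_v(b, c) ≤ GL_n(K_v)`**: matrices in `GL_n(𝒪_v)` which are upper
triangular modulo `ϖ_v^{max b c}` and unipotent upper triangular modulo `ϖ_v^b` — the subgroups
`Iw_v(b,c)` (`c ≥ b ≥ 0`) of [cite: AllenCalegariCaraianiGeeEtAl2023, §2.2.2] (= `I_v(b,c)` of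
[cite: KhareThorne2017, §6.2 (definition of I_v(b,c))] up to the centre), realised as the valued Iwahori subgroup of
radii `(|ϖ_v|^b, |ϖ_v|^c)`; `Iw_v(0,1)` is the Iwahori subgroup, `Iw_v(0,0) = GL_n(𝒪_v)`. -/
abbrev iwahoriLevel (v : HeightOneSpectrum (𝓞 K)) (b c : ℕ) :
    Subgroup (GL (Fin n) (v.adicCompletion K)) :=
  valuedIwahoriSubgroup (Fin n) (WithZero.exp (-(b : ℤ)) : WithZero (Multiplicative ℤ))
    (WithZero.exp (-(c : ℤ)))

/-- The Iwahori levels decrease in both parameters. [folklore] -/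
theorem iwahoriLevel_antitone (v : HeightOneSpectrum (𝓞 K)) {b b' c c' : ℕ} (hb : b ≤ b')
    (hc : c ≤ c') : iwahoriLevel n v b' c' ≤ iwahoriLevel n v b c :=
  valuedIwahoriSubgroup_antitone (WithZero.exp_le_exp.2 (neg_le_neg (Int.ofNat_le.2 hb)))
    (WithZero.exp_le_exp.2 (neg_le_neg (Int.ofNat_le.2 hc)))

/-- Closed balls of nonzero radius in `K_v` are open. [folklore] -/
private theorem isOpen_setOf_valued_le (v : HeightOneSpectrum (𝓞 K))
    {r : WithZero (Multiplicative ℤ)} (hr : r ≠ 0) :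
    IsOpen {y : v.adicCompletion K | Valued.v y ≤ r} := by
  obtain ⟨z, hz⟩ := v.valuation_surjective K r
  have hz' : Valued.v (z : v.adicCompletion K) = r := by
    rw [HeightOneSpectrum.valuedAdicCompletion_eq_valuation', hz]
  have hne : Valued.v.restrict (z : v.adicCompletion K) ≠ 0 := by
    rw [Ne, Valuation.restrict_eq_zero_iff, hz']
    exact hr
  have h := Valued.isOpen_closedBall (v.adicCompletion K) hne
  simp only [Valuation.restrict_le_iff, hz'] at h
  exact h

/-- The Iwahori conditions as a finite intersection of ball conditions. [folklore] -/
private theorem setOf_iwahoriCond_eq (v : HeightOneSpectrum (𝓞 K)) (β γ : WithZero (Multiplicative ℤ)) :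
    {A : Matrix (Fin n) (Fin n) (v.adicCompletion K) | IwahoriCond (Fin n) β γ A} =
      (⋂ i, ⋂ j, {A | Valued.v (A i j) ≤ 1}) ∩
        (⋂ i, ⋂ j, {A | j < i → Valued.v (A i j) ≤ min β γ}) ∩
          ⋂ i, {A | Valued.v ((A - 1) i i) ≤ β} := by
  ext A
  simp only [Set.mem_setOf_eq, Set.mem_inter_iff, Set.mem_iInter, Matrix.sub_apply,
    Matrix.one_apply_eq]
  exact ⟨fun h => ⟨⟨h.le_one, h.lower⟩, h.diag⟩, fun h => ⟨h.1.1, h.1.2, h.2⟩⟩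

/-- `Iw_v(b,c)` is open in `GL_n(K_v)`. [folklore] -/
theorem isOpen_iwahoriLevel (v : HeightOneSpectrum (𝓞 K)) (b c : ℕ) :
    IsOpen (iwahoriLevel n v b c : Set (GL (Fin n) (v.adicCompletion K))) := by
  set β : WithZero (Multiplicative ℤ) := WithZero.exp (-(b : ℤ))
  set γ : WithZero (Multiplicative ℤ) := WithZero.exp (-(c : ℤ))
  have hS : IsOpen {A : Matrix (Fin n) (Fin n) (v.adicCompletion K) | IwahoriCond (Fin n) β γ A} := by
    rw [setOf_iwahoriCond_eq]
    refine ((isOpen_iInter_of_finite fun i => isOpen_iInter_of_finite fun j =>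
      (isOpen_setOf_valued_le v one_ne_zero).preimage (continuous_id.matrix_elem i j)).inter
      (isOpen_iInter_of_finite fun i => isOpen_iInter_of_finite fun j => ?_)).inter
      (isOpen_iInter_of_finite fun i => (isOpen_setOf_valued_le v WithZero.coe_ne_zero).preimage
        ((continuous_id.sub continuous_const).matrix_elem i i))
    by_cases hij : j < i
    · simp only [hij, forall_true_left]
      refine (isOpen_setOf_valued_le v ?_).preimage (continuous_id.matrix_elem i j)
      exact (lt_min WithZero.exp_pos WithZero.exp_pos).ne'
    · simp only [hij, IsEmpty.forall_iff, Set.setOf_true, isOpen_univ]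
  have hset : (iwahoriLevel n v b c : Set (GL (Fin n) (v.adicCompletion K))) =
      (fun g : GL (Fin n) (v.adicCompletion K) => (g : Matrix (Fin n) (Fin n) (v.adicCompletion K))) ⁻¹'
        {A | IwahoriCond (Fin n) β γ A} ∩
      (fun g : GL (Fin n) (v.adicCompletion K) =>
        ((g⁻¹ : GL (Fin n) (v.adicCompletion K)) : Matrix (Fin n) (Fin n) (v.adicCompletion K))) ⁻¹'
        {A | IwahoriCond (Fin n) β γ A} := rfl
  rw [hset]
  exact (hS.preimage Units.continuous_val).inter (hS.preimage Units.continuous_coe_inv)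

namespace TameLevel

variable {p : ℕ} [Fact p.Prime] (𝒰 : TameLevel n K p)

/-- **The level `U(r)` of the Hida tower** of the tame level `𝒰`: `u ∈ U` with
`u_v ∈ Iw_v(r, max r 1)` for every `v ∣ p` — i.e. `u_v` is upper triangular mod `ϖ_v^{max r 1}`
and unipotent mod `ϖ_v^r`; for `U` maximal at `p` (`IsMaximalAbove`) this is the good subgroup
`K(r, max r 1)` of [cite: AllenCalegariCaraianiGeeEtAl2023, §5.1] (`K(0,1)`: Iwahori level at
`p`; `K(r,r) = U(r,r)` of [cite: KhareThorne2017, §6.3] for `r ≥ 1`, there modulo the centre). -/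
def hidaLevel (r : ℕ) : Subgroup (FiniteAdelicGL n K) :=
  𝒰.subgroup ⊓ ⨅ v : {v : HeightOneSpectrum (𝓞 K) // (p : 𝓞 K) ∈ v.asIdeal},
    (iwahoriLevel n v.1 r (max r 1)).comap (localComponent n K v.1)

/-- Membership in `U(r)` (definitional). [folklore] -/
theorem mem_hidaLevel_iff (r : ℕ) (u : FiniteAdelicGL n K) :
    u ∈ 𝒰.hidaLevel r ↔ u ∈ 𝒰.subgroup ∧ ∀ w : HeightOneSpectrum (𝓞 K), (p : 𝓞 K) ∈ w.asIdeal →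
      localComponent n K w u ∈ iwahoriLevel n w r (max r 1) := by
  simp only [hidaLevel, Subgroup.mem_inf, Subgroup.mem_iInf, Subgroup.mem_comap, Subtype.forall]

/-- `U(r) ≤ U`. [folklore] -/
theorem hidaLevel_le (r : ℕ) : 𝒰.hidaLevel r ≤ 𝒰.subgroup := inf_le_left

/-- The `U(r)` decrease. [folklore] -/
theorem hidaLevel_antitone : Antitone 𝒰.hidaLevel := fun _ _ h =>
  inf_le_inf_left _ (iInf_mono fun v => Subgroup.comap_mono
    (iwahoriLevel_antitone v.1 h (max_le_max h le_rfl)))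

/-- `U(r)` is open (a finite intersection of open subgroups). [folklore] -/
theorem isOpen_hidaLevel (r : ℕ) : IsOpen (𝒰.hidaLevel r : Set (FiniteAdelicGL n K)) := by
  rw [hidaLevel, Subgroup.coe_inf, Subgroup.coe_iInf]
  haveI : Finite {v : HeightOneSpectrum (𝓞 K) // (p : 𝓞 K) ∈ v.asIdeal} :=
    finite_setOf_natCast_mem_asIdeal K p
  refine 𝒰.isOpen.inter (isOpen_iInter_of_finite fun v => ?_)
  rw [Subgroup.coe_comap]
  exact (isOpen_iwahoriLevel v.1 _ _).preimage (continuous_localComponent n K _)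

/-- `U(r)` is compact (closed in the compact `U`). [folklore] -/
theorem isCompact_hidaLevel (r : ℕ) : IsCompact (𝒰.hidaLevel r : Set (FiniteAdelicGL n K)) := by
  rw [hidaLevel, Subgroup.coe_inf, Subgroup.coe_iInf]
  refine 𝒰.isCompact.of_isClosed_subset ((Subgroup.isClosed_of_isOpen _ 𝒰.isOpen).inter
    (isClosed_iInter fun v => ?_)) Set.inter_subset_left
  rw [Subgroup.coe_comap]
  exact (Subgroup.isClosed_of_isOpen _ (isOpen_iwahoriLevel v.1 _ _)).preimage
    (continuous_localComponent n K _)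

/-- `U(r)` is a Hecke subgroup of `GL_n(𝔸_K^∞)` (compact open). [folklore] -/
instance isHeckeTriple_hidaLevel (r : ℕ) :
    IsHeckeTriple (⊤ : Submonoid (FiniteAdelicGL n K)) (𝒰.hidaLevel r) (𝒰.hidaLevel r) :=
  isHeckeTriple_top_of_isCompact_isOpen _ (𝒰.isCompact_hidaLevel r) (𝒰.isOpen_hidaLevel r)

/-- **The Hida tower** `U(0) ≥ U(1) ≥ ⋯` of the tame level `𝒰` as a `LevelTower` (Iwahori level
at `p`, then the levels `Iw_v(r,r)`, `v ∣ p`) — the tower `K(b,c)`, `b = r`, `c = max r 1`, of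
[cite: AllenCalegariCaraianiGeeEtAl2023, §5.1] along which Hida's ordinary parts are formed
([cite: KhareThorne2017, §6.3]: `U(c,c)`). -/
def hidaTower : LevelTower (FiniteAdelicGL n K) :=
  ⟨𝒰.hidaLevel, 𝒰.hidaLevel_antitone⟩

/-- The levels of the Hida tower are the `U(r)` (definitional). [folklore] -/
@[simp]
theorem hidaTower_level (r : ℕ) : 𝒰.hidaTower.level r = 𝒰.hidaLevel r :=
  rfl

/-- **`U` is maximal (hyperspecial and factorizable) at the places above `p`**: `U ⊇ ι_v(GL_n(𝒪_v))`
and `U` is stable under deleting the `v`-component, for every `v ∣ p` — so that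
`U = U^p × ∏_{v ∣ p} GL_n(𝒪_v)` and the Hida levels are `U(r) = U^p × ∏_{v ∣ p} Iw_v(r, max r 1)`,
the standing shape of the good subgroups `K(b,c)` in [cite: AllenCalegariCaraianiGeeEtAl2023, §5.1]
and `U(b,c)` in [cite: KhareThorne2017, §6.3]. Holds for `TameLevel.full` (`isMaximalAbove_full`). -/
structure IsMaximalAbove : Prop where
  /-- `ι_v(GL_n(𝒪_v)) ≤ U` for `v ∣ p`. -/
  ofLocal_mem : ∀ v : HeightOneSpectrum (𝓞 K), (p : 𝓞 K) ∈ v.asIdeal →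
    ∀ g ∈ valuedCongruenceSubgroup (Fin n) (1 : WithZero (Multiplicative ℤ)), ofLocal n K v g ∈ 𝒰.subgroup
  /-- deleting the `v`-component of `u ∈ U` stays in `U`, for `v ∣ p`. -/
  mul_ofLocal_inv_mem : ∀ v : HeightOneSpectrum (𝓞 K), (p : 𝓞 K) ∈ v.asIdeal →
    ∀ u ∈ 𝒰.subgroup, u * (ofLocal n K v (localComponent n K v u))⁻¹ ∈ 𝒰.subgroup

omit 𝒰 in
variable (n K p) in
/-- The full tame level `GL_n(𝒪̂_K)` is maximal above `p`. [folklore] -/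
theorem isMaximalAbove_full : (TameLevel.full n K p).IsMaximalAbove where
  ofLocal_mem v _ g hg :=
    (mem_glIntegralLevel_iff.1 (isMaximalAt_glIntegralLevel n K v ⟨g, hg, rfl⟩)).1
  mul_ofLocal_inv_mem v _ _ hu := mul_mem hu (inv_mem (mem_glIntegralLevel_iff.1
    (isMaximalAt_glIntegralLevel n K v
      ⟨_, localComponent_mem_valuedCongruenceSubgroup_one hu v, rfl⟩)).1)

end TameLevel

end BigHeckeGLn

/-! ### Conjugation by diagonal units preserves the Iwahori conditions -/

section DiagUnits

variable {F Γ₀ : Type*} [Field F] [LinearOrderedCommGroupWithZero Γ₀] [Valued F Γ₀] {n : ℕ}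

/-- Entries of `d⁻¹ x d` for a diagonal `d`. [folklore] -/
theorem coe_glDiagonal_inv_mul_mul_apply (d : Fin n → Fˣ) (x : GL (Fin n) F) (j k : Fin n) :
    (((glDiagonal n F d)⁻¹ * x * glDiagonal n F d : GL (Fin n) F) : Matrix (Fin n) (Fin n) F) j k =
      ((d j)⁻¹ : Fˣ) * (x : Matrix (Fin n) (Fin n) F) j k * (d k : F) := by
  rw [← map_inv, Units.val_mul, Units.val_mul, coe_glDiagonal, coe_glDiagonal, Matrix.mul_diagonal,
    Matrix.diagonal_mul, Pi.inv_apply]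

/-- Conjugation by a diagonal matrix of UNITS of `𝒪_F` does not change the valuations of the
entries, hence preserves the Iwahori conditions (the diamond operators normalise `Iw(β, γ)`).
[folklore] -/
theorem IwahoriCond.glDiagonal_conj {β γ : Γ₀} {d : Fin n → Fˣ} (hd : ∀ j, Valued.v (d j : F) = 1)
    {x : GL (Fin n) F} (hx : IwahoriCond (Fin n) β γ (x : Matrix (Fin n) (Fin n) F)) :
    IwahoriCond (Fin n) β γ
      (((glDiagonal n F d)⁻¹ * x * glDiagonal n F d : GL (Fin n) F) : Matrix (Fin n) (Fin n) F) := by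
  have hv : ∀ j k, Valued.v ((((glDiagonal n F d)⁻¹ * x * glDiagonal n F d : GL (Fin n) F) :
      Matrix (Fin n) (Fin n) F) j k) = Valued.v ((x : Matrix (Fin n) (Fin n) F) j k) := by
    intro j k
    rw [coe_glDiagonal_inv_mul_mul_apply, map_mul, map_mul, Units.val_inv_eq_inv_val, map_inv₀, hd,
      hd, inv_one, one_mul, mul_one]
  refine ⟨fun j k => (hv j k).trans_le (hx.le_one j k), fun j k h => (hv j k).trans_le (hx.lower j k h),
    fun j => ?_⟩
  have : (((glDiagonal n F d)⁻¹ * x * glDiagonal n F d : GL (Fin n) F) : Matrix (Fin n) (Fin n) F) j j =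
      (x : Matrix (Fin n) (Fin n) F) j j := by
    rw [coe_glDiagonal_inv_mul_mul_apply, mul_comm, ← mul_assoc, Units.mul_inv, one_mul]
  rw [this]
  exact hx.diag j

/-- `d⁻¹ (Iw(β,γ)) d ⊆ Iw(β,γ)` for a diagonal matrix `d` of units. [folklore] -/
theorem glDiagonal_conj_mem_valuedIwahoriSubgroup {β γ : Γ₀} {d : Fin n → Fˣ}
    (hd : ∀ j, Valued.v (d j : F) = 1) {x : GL (Fin n) F} (hx : x ∈ valuedIwahoriSubgroup (Fin n) β γ) :
    (glDiagonal n F d)⁻¹ * x * glDiagonal n F d ∈ valuedIwahoriSubgroup (Fin n) β γ := by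
  refine ⟨hx.1.glDiagonal_conj hd, ?_⟩
  have : ((glDiagonal n F d)⁻¹ * x * glDiagonal n F d)⁻¹ = (glDiagonal n F d)⁻¹ * x⁻¹ * glDiagonal n F d := by
    group
  rw [this]
  exact hx.2.glDiagonal_conj hd

/-- A diagonal matrix of units of `𝒪_F` lies in `GL_n(𝒪_F)` (general valued-field form of
`glDiagonal_mem_valuedCongruenceSubgroup_one` of `UnramifiedHeckeScalars`, which is stated for `K_v`
and lives outside this file's import cone). [folklore] -/
theorem glDiagonal_mem_valuedCongruenceSubgroup_one_of_eq_one {d : Fin n → Fˣ}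
    (hd : ∀ j, Valued.v (d j : F) = 1) :
    glDiagonal n F d ∈ valuedCongruenceSubgroup (Fin n) (1 : Γ₀) := by
  have hdiag : ∀ (e : Fin n → Fˣ), (∀ j, Valued.v (e j : F) = 1) →
      ∀ i j, Valued.v ((glDiagonal n F e : Matrix (Fin n) (Fin n) F) i j) ≤ 1 := by
    intro e he i j
    rw [coe_glDiagonal, Matrix.diagonal_apply]
    split_ifs
    · exact (he i).le
    · simp
  refine (mem_valuedCongruenceSubgroup_iff (m := Fin n)).2 ⟨hdiag d hd, ?_, fun i j => ?_⟩
  · rw [← map_inv]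
    exact hdiag d⁻¹ fun j => by
      rw [Pi.inv_apply, Units.val_inv_eq_inv_val, map_inv₀, hd, inv_one]
  · rw [Matrix.sub_apply]
    refine (Valued.v.map_sub _ _).trans (max_le (hdiag d hd i j) ?_)
    rw [Matrix.one_apply]; split_ifs <;> simp

end DiagUnits

namespace BigHeckeGLn

variable {n : ℕ} {K : Type} [Field K] [NumberField K]

/-! ### Local shapes of the Hecke elements at `p` and the diamond elements -/

/-- `(t_{v,i})_w = 1` for `w ≠ v`. [folklore] -/
private theorem localComponent_heckeElement_ne {v w : HeightOneSpectrum (𝓞 K)} (h : w ≠ v) (i : ℕ) :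
    localComponent n K w (heckeElement n K v i) = 1 := by
  rw [heckeElement_eq_ofLocal, localComponent_ofLocal_of_ne h]

/-- `(t_{v,i})_v = diag(ϖ_v^{(i)}, 1^{(n-i)})` is the cut torus element. [folklore] -/
theorem localComponent_heckeElement_self (v : HeightOneSpectrum (𝓞 K)) (i : ℕ) :
    localComponent n K v (heckeElement n K v i) = cutDiag (uniformizerAt v) i := by
  rw [heckeElement_eq_ofLocal, localComponent_ofLocal]
  rfl

/-- `t_{v,i} = ι_v(diag(ϖ_v^{(i)}, 1^{(n-i)}))`. [folklore] -/
theorem heckeElement_eq_ofLocal_cutDiag (v : HeightOneSpectrum (𝓞 K)) (i : ℕ) :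
    heckeElement n K v i = ofLocal n K v (cutDiag (uniformizerAt v) i) :=
  heckeElement_eq_ofLocal v i

/-- `t_{v,n} = ι_v(ϖ_v · 1)` is central in `GL_n(𝔸_K^∞)`. [folklore] -/
theorem heckeElement_self_mul_comm (v : HeightOneSpectrum (𝓞 K)) (x : FiniteAdelicGL n K) :
    heckeElement n K v n * x = x * heckeElement n K v n := by
  refine Matrix.GeneralLinearGroup.ext fun a b => ?_
  rw [Units.val_mul, Units.val_mul, heckeElement, coe_glDiagonal, Matrix.diagonal_mul,
    Matrix.mul_diagonal, if_pos a.isLt, if_pos b.isLt, mul_comm]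

/-- Conjugation of a finite-adelic element by a local element `ι_v(g)`: it factors as the
`v`-deprived part of `y` times `ι_v(g⁻¹ y_v g)` (a variant of `ofLocal_inv_mul_mul_ofLocal` of
`CompletedCohomologyActionGL`, outside this file's import cone). [folklore] -/
private theorem conj_ofLocal_eq_mul_ofLocal (v : HeightOneSpectrum (𝓞 K)) (g : GL (Fin n) (v.adicCompletion K))
    (y : FiniteAdelicGL n K) :
    (ofLocal n K v g)⁻¹ * y * ofLocal n K v g =
      y * (ofLocal n K v (localComponent n K v y))⁻¹ *
        ofLocal n K v (g⁻¹ * localComponent n K v y * g) := by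
  refine ext_localComponent fun w => ?_
  by_cases hw : w = v
  · subst hw
    simp only [map_mul, map_inv, localComponent_ofLocal]
    rw [mul_inv_cancel, one_mul]
  · simp only [map_mul, map_inv, localComponent_ofLocal_of_ne hw, inv_one, one_mul, mul_one]

/-- The units of `𝒪_v` have valuation `1` in `K_v`. [folklore] -/
theorem valued_coe_units_adicCompletionIntegers (v : HeightOneSpectrum (𝓞 K))
    (u : (v.adicCompletionIntegers K)ˣ) :
    Valued.v (((u : v.adicCompletionIntegers K) : v.adicCompletion K)) = 1 := by
  have h1 : Valued.v (((u : v.adicCompletionIntegers K) : v.adicCompletion K)) ≤ 1 :=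
    (HeightOneSpectrum.mem_adicCompletionIntegers (R := 𝓞 K) K v).1 (u : v.adicCompletionIntegers K).2
  have h2 : Valued.v ((((u⁻¹ : (v.adicCompletionIntegers K)ˣ) : v.adicCompletionIntegers K) :
      v.adicCompletion K)) ≤ 1 :=
    (HeightOneSpectrum.mem_adicCompletionIntegers (R := 𝓞 K) K v).1 (_ : v.adicCompletionIntegers K).2
  have hmul : Valued.v (((u : v.adicCompletionIntegers K) : v.adicCompletion K)) *
      Valued.v ((((u⁻¹ : (v.adicCompletionIntegers K)ˣ) : v.adicCompletionIntegers K) :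
        v.adicCompletion K)) = 1 := by
    rw [← map_mul, ← Subring.coe_mul, ← Units.val_mul, mul_inv_cancel, Units.val_one,
      OneMemClass.coe_one, map_one]
  refine le_antisymm h1 ?_
  calc (1 : WithZero (Multiplicative ℤ)) = _ := hmul.symm
    _ ≤ Valued.v (((u : v.adicCompletionIntegers K) : v.adicCompletion K)) * 1 :=
        mul_le_mul_right h2 _
    _ = _ := mul_one _

variable (n) in
/-- The local units `T_n(𝒪_v) → (K_vˣ)^n`, `u ↦ (u_k)_k` viewed in `K_v`. [folklore] -/
def unitsToLocal (v : HeightOneSpectrum (𝓞 K)) :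
    (Fin n → (v.adicCompletionIntegers K)ˣ) →* (Fin n → (v.adicCompletion K)ˣ) :=
  MonoidHom.compLeft (Units.map ((v.adicCompletionIntegers K).subtype : _ →* v.adicCompletion K)) (Fin n)

/-- The entries of `unitsToLocal` are units of `𝒪_v` (valuation `1`). [folklore] -/
theorem valued_unitsToLocal (v : HeightOneSpectrum (𝓞 K)) (u : Fin n → (v.adicCompletionIntegers K)ˣ)
    (j : Fin n) : Valued.v ((unitsToLocal n v u j : (v.adicCompletion K)ˣ) : v.adicCompletion K) = 1 :=
  valued_coe_units_adicCompletionIntegers v (u j)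

variable (n K) in
/-- **The diamond element `⟨u⟩_v = ι_v(diag(u_1, …, u_n)) ∈ GL_n(𝔸_K^∞)`** of `u ∈ T_n(𝒪_v)`
(a group homomorphism); its double cosets `[Iw u Iw]` are the diamond operators `⟨u⟩` of
[cite: AllenCalegariCaraianiGeeEtAl2023, §2.2.2] ([cite: KhareThorne2017, §6.2]: `⟨α⟩`). -/
def diamondElement (v : HeightOneSpectrum (𝓞 K)) :
    (Fin n → (v.adicCompletionIntegers K)ˣ) →* FiniteAdelicGL n K :=
  (ofLocal n K v).comp ((glDiagonal n (v.adicCompletion K)).comp (unitsToLocal n v))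

/-- Unfolding `diamondElement`. [folklore] -/
theorem diamondElement_apply (v : HeightOneSpectrum (𝓞 K)) (u : Fin n → (v.adicCompletionIntegers K)ˣ) :
    diamondElement n K v u = ofLocal n K v (glDiagonal n (v.adicCompletion K) (unitsToLocal n v u)) :=
  rfl

namespace TameLevel

variable {p : ℕ} [Fact p.Prime] (𝒰 : TameLevel n K p)

/-! ### Level-compatibility of the Hecke elements along the Hida tower -/

/-- **Elements normalising every level are level-compatible.** If `x ∈ U(r) ↔ g⁻¹ x g ∈ U(r)` for
all `r` (e.g. `g` central, or a diamond element), the double cosets `U(r') g U(r') / U(r') →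
U(r) g U(r) / U(r)` correspond bijectively (both are the single coset `g U`). [folklore] -/
theorem bijOn_hidaLevel_of_conj {g : FiniteAdelicGL n K}
    (hg : ∀ r x, x ∈ 𝒰.hidaLevel r → g⁻¹ * x * g ∈ 𝒰.hidaLevel r) {r r' : ℕ} (h : r ≤ r') :
    Set.BijOn (Subgroup.quotientMapOfLE (𝒰.hidaLevel_antitone h))
      (ArithmeticQuotient.doubleCosetQuot (𝒰.hidaLevel r') g)
      (ArithmeticQuotient.doubleCosetQuot (𝒰.hidaLevel r) g) :=
  ArithmeticQuotient.bijOn_doubleCosetQuot _ _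
    (fun l hl => ⟨1, one_mem _, g⁻¹ * l * g, hg r l hl, by group⟩) fun l' hl' _ => hg r' l' hl'

/-- Elements normalising every level act level-compatibly on the Hida tower. [folklore] -/
theorem isTowerCompatible_of_conj (k : Type) [CommRing k] {g : FiniteAdelicGL n K}
    (hg : ∀ r x, x ∈ 𝒰.hidaLevel r → g⁻¹ * x * g ∈ 𝒰.hidaLevel r) :
    IsTowerCompatible k (globalEmbedding n K) 𝒰.hidaTower (p : k) g :=
  isTowerCompatible_of_bijOn k (globalEmbedding n K) 𝒰.hidaTower (p : k) g
    (fun h => 𝒰.bijOn_hidaLevel_of_conj hg h) fun r => finite_orbit_quotient (𝒰.hidaLevel r) g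

/-- `t_{w,n}` (central) is level-compatible on the Hida tower. [folklore] -/
theorem isTowerCompatible_heckeElement_self (k : Type) [CommRing k] (w : HeightOneSpectrum (𝓞 K)) :
    IsTowerCompatible k (globalEmbedding n K) 𝒰.hidaTower (p : k) (heckeElement n K w n) :=
  𝒰.isTowerCompatible_of_conj k fun r x hx => by
    rwa [mul_assoc, ← heckeElement_self_mul_comm, ← mul_assoc, inv_mul_cancel, one_mul]

/-- `t_{w,n}⁻¹` (central) is level-compatible on the Hida tower. [folklore] -/
theorem isTowerCompatible_heckeElement_self_inv (k : Type) [CommRing k] (w : HeightOneSpectrum (𝓞 K)) :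
    IsTowerCompatible k (globalEmbedding n K) 𝒰.hidaTower (p : k) (heckeElement n K w n)⁻¹ :=
  𝒰.isTowerCompatible_of_conj k fun r x hx => by
    rwa [inv_inv, heckeElement_self_mul_comm, mul_assoc, mul_inv_cancel, mul_one]

variable {𝒰}

/-- The `w`-part of an element of `U` lies in every Hida level, for a good place `w ∉ S` (the Hida
levels only shrink above `p`, and `U` is hyperspecial at `w`). [folklore] -/
theorem ofLocal_localComponent_mem_hidaLevel {w : HeightOneSpectrum (𝓞 K)} (hw : w ∉ 𝒰.bad)
    {u : FiniteAdelicGL n K} (hu : u ∈ 𝒰.subgroup) (r : ℕ) :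
    ofLocal n K w (localComponent n K w u) ∈ 𝒰.hidaLevel r := by
  rw [mem_hidaLevel_iff]
  refine ⟨𝒰.ofLocal_mem w hw _ (localComponent_mem_valuedCongruenceSubgroup_one
    (𝒰.le_glFiniteIntegralLevel hu) w), fun w' hw' => ?_⟩
  have hne : w' ≠ w := fun h => hw (𝒰.mem_bad_of_mem w (h ▸ hw'))
  rw [localComponent_ofLocal_of_ne hne]
  exact one_mem _

/-- **`t_{w,j}`, `w ∉ S`, is level-compatible on the Hida tower** (same argument as for the
`p`-power tower, `bijOn_tower_heckeElement`: `U(r) = U(r') (U(r) ∩ t U(r) t⁻¹)` via the `w`-part,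
and conjugation by `t` does not move the components above `p`). [cite: KhareThorne2017, §6.2, Lemma 6.5] -/
theorem bijOn_hidaLevel_heckeElement {w : HeightOneSpectrum (𝓞 K)} (hw : w ∉ 𝒰.bad) (j : ℕ)
    {r r' : ℕ} (h : r ≤ r') :
    Set.BijOn (Subgroup.quotientMapOfLE (𝒰.hidaLevel_antitone h))
      (ArithmeticQuotient.doubleCosetQuot (𝒰.hidaLevel r') (heckeElement n K w j))
      (ArithmeticQuotient.doubleCosetQuot (𝒰.hidaLevel r) (heckeElement n K w j)) := by
  refine ArithmeticQuotient.bijOn_doubleCosetQuot (𝒰.hidaLevel_antitone h) _ (fun l hl => ?_)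
    (fun l' hl' hc => ?_)
  · have hlU : l ∈ 𝒰.subgroup := 𝒰.hidaLevel_le r hl
    set l' := ofLocal n K w (localComponent n K w l) with hl'def
    have hm1 : localComponent n K w (l'⁻¹ * l) = 1 := by
      rw [map_mul, map_inv, hl'def, localComponent_ofLocal, inv_mul_cancel]
    have hcomm : l'⁻¹ * l * heckeElement n K w j = heckeElement n K w j * (l'⁻¹ * l) := by
      rw [heckeElement_eq_ofLocal]
      exact mul_ofLocal_comm hm1 _
    have hconj : (heckeElement n K w j)⁻¹ * (l'⁻¹ * l) * heckeElement n K w j = l'⁻¹ * l := by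
      rw [mul_assoc, hcomm, ← mul_assoc, inv_mul_cancel, one_mul]
    refine ⟨l', ofLocal_localComponent_mem_hidaLevel hw hlU r',
      (heckeElement n K w j)⁻¹ * (l'⁻¹ * l) * heckeElement n K w j, ?_, by group⟩
    rw [hconj]
    exact mul_mem (inv_mem (ofLocal_localComponent_mem_hidaLevel hw hlU r)) hl
  · rw [mem_hidaLevel_iff] at hl' hc ⊢
    refine ⟨hc.1, fun w' hw' => ?_⟩
    have hne : w' ≠ w := fun h' => hw (𝒰.mem_bad_of_mem w (h' ▸ hw'))
    rw [map_mul, map_mul, map_inv, localComponent_heckeElement_ne hne, inv_one, one_mul, mul_one]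
    exact hl'.2 w' hw'

variable (𝒰) in
/-- `t_{w,j}`, `w ∉ S`, acts level-compatibly on the Hida tower. [cite: KhareThorne2017, §6.2, Lemma 6.5] -/
theorem isTowerCompatible_heckeElement_of_not_mem (k : Type) [CommRing k]
    {w : HeightOneSpectrum (𝓞 K)} (hw : w ∉ 𝒰.bad) (j : ℕ) :
    IsTowerCompatible k (globalEmbedding n K) 𝒰.hidaTower (p : k) (heckeElement n K w j) :=
  isTowerCompatible_of_bijOn k (globalEmbedding n K) 𝒰.hidaTower (p : k) _
    (fun h => bijOn_hidaLevel_heckeElement hw j h) fun r => finite_orbit_quotient (𝒰.hidaLevel r) _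

/-- `|ϖ_v| ≤ 1`. [folklore] -/
private theorem valued_uniformizerAt_le_one (v : HeightOneSpectrum (𝓞 K)) :
    Valued.v ((uniformizerAt v : (v.adicCompletion K)ˣ) : v.adicCompletion K) ≤ 1 := by
  rw [valued_uniformizerAt_aux, ← WithZero.exp_zero]
  exact WithZero.exp_le_exp.2 (by norm_num)

/-- `min(|ϖ_v|^r, |ϖ_v|^{max r 1}) ≤ |ϖ_v|`. [folklore] -/
private theorem min_radius_le (v : HeightOneSpectrum (𝓞 K)) (r : ℕ) :
    min (WithZero.exp (-(r : ℤ)) : WithZero (Multiplicative ℤ)) (WithZero.exp (-((max r 1 : ℕ) : ℤ))) ≤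
      Valued.v ((uniformizerAt v : (v.adicCompletion K)ˣ) : v.adicCompletion K) := by
  rw [valued_uniformizerAt_aux]
  exact min_le_of_right_le (WithZero.exp_le_exp.2 (neg_le_neg (by exact_mod_cast le_max_right r 1)))

/-- **`t_{v,i}`, `v ∣ p`, is level-compatible on the Hida tower of a tame level maximal above `p`**:
`U(r') t U(r') / U(r') → U(r) t U(r) / U(r)` is a bijection for `r ≤ r'` — from the Iwahori
factorisation across the cut `i` at `v` (`exists_unipotent_cutDiag_conj_mem`: `U(r) = ι_v(N(𝒪_v))
· (U(r) ∩ t U(r) t⁻¹)`) and the fact that `t⁻¹ (·) t` preserves `Iw_v(r', ·)` on elements it keeps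
integral. This is the level-independence of the operators `U_{v,i}` of
[cite: KhareThorne2017, §6.2, Lemma 6.5 (2)] (there via coset representatives independent of the
level; cf. [cite: AllenCalegariCaraianiGeeEtAl2023, §2.2.2]). -/
theorem bijOn_hidaLevel_heckeElement_of_mem (h𝒰 : 𝒰.IsMaximalAbove) {v : HeightOneSpectrum (𝓞 K)}
    (hv : (p : 𝓞 K) ∈ v.asIdeal) (i : ℕ) {r r' : ℕ} (h : r ≤ r') :
    Set.BijOn (Subgroup.quotientMapOfLE (𝒰.hidaLevel_antitone h))
      (ArithmeticQuotient.doubleCosetQuot (𝒰.hidaLevel r') (heckeElement n K v i))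
      (ArithmeticQuotient.doubleCosetQuot (𝒰.hidaLevel r) (heckeElement n K v i)) := by
  have hϖ1 := valued_uniformizerAt_le_one (K := K) v
  set tl : GL (Fin n) (v.adicCompletion K) := cutDiag (uniformizerAt v) i with htl
  have ht : heckeElement n K v i = ofLocal n K v tl := heckeElement_eq_ofLocal_cutDiag v i
  have hIw_le : ∀ b c : ℕ, iwahoriLevel n v b c ≤
      valuedCongruenceSubgroup (Fin n) (1 : WithZero (Multiplicative ℤ)) :=
    fun b c => valuedIwahoriSubgroup_le_valuedCongruenceSubgroup_one
  refine ArithmeticQuotient.bijOn_doubleCosetQuot (𝒰.hidaLevel_antitone h) _ (fun l hl => ?_)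
    (fun l' hl' hc => ?_)
  · -- (a) Iwahori factorisation at `v`
    obtain ⟨hlU, hlw⟩ := (𝒰.mem_hidaLevel_iff r l).1 hl
    obtain ⟨u, hu, hconj⟩ := exists_unipotent_cutDiag_conj_mem hϖ1 (min_radius_le v r) i (hlw v hv)
    have huU : ofLocal n K v u ∈ 𝒰.subgroup := h𝒰.ofLocal_mem v hv u (hIw_le r' (max r' 1) (hu _ _))
    refine ⟨ofLocal n K v u, ?_, (heckeElement n K v i)⁻¹ * ((ofLocal n K v u)⁻¹ * l) *
      heckeElement n K v i, ?_, by group⟩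
    · rw [mem_hidaLevel_iff]
      refine ⟨huU, fun w hw => ?_⟩
      by_cases hwv : w = v
      · subst hwv
        rw [localComponent_ofLocal]
        exact hu _ _
      · rw [localComponent_ofLocal_of_ne hwv]
        exact one_mem _
    · set y := (ofLocal n K v u)⁻¹ * l with hy
      have hyU : y ∈ 𝒰.subgroup := mul_mem (inv_mem huU) hlU
      have hyv : localComponent n K v y = u⁻¹ * localComponent n K v l := by
        rw [hy, map_mul, map_inv, localComponent_ofLocal]
      have hloc : tl⁻¹ * localComponent n K v y * tl ∈ iwahoriLevel n v r (max r 1) := by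
        rw [hyv]; exact hconj
      rw [ht, conj_ofLocal_eq_mul_ofLocal, mem_hidaLevel_iff]
      refine ⟨mul_mem (h𝒰.mul_ofLocal_inv_mem v hv y hyU)
        (h𝒰.ofLocal_mem v hv _ (hIw_le r (max r 1) hloc)), fun w hw => ?_⟩
      by_cases hwv : w = v
      · subst hwv
        simp only [map_mul, map_inv, localComponent_ofLocal, mul_inv_cancel, one_mul]
        exact hloc
      · simp only [map_mul, map_inv, localComponent_ofLocal_of_ne hwv, inv_one, mul_one]
        rw [hy, map_mul, map_inv, localComponent_ofLocal_of_ne hwv, inv_one, one_mul]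
        exact hlw w hw
  · -- (b) conjugation by `t` preserves the deeper level on elements it keeps integral
    rw [mem_hidaLevel_iff] at hl' hc ⊢
    refine ⟨hc.1, fun w hw => ?_⟩
    by_cases hwv : w = v
    · subst hwv
      have hcw := hc.2 w hw
      rw [map_mul, map_mul, map_inv, localComponent_heckeElement_self] at hcw ⊢
      have hl'w := hl'.2 w hw
      refine ⟨hl'w.1.cutDiag_conj hϖ1 (topRightDivisible_of_le_one hcw.1.le_one), ?_⟩
      have hinv : ((cutDiag (uniformizerAt w) i)⁻¹ * localComponent n K w l' * cutDiag (uniformizerAt w) i)⁻¹ =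
          (cutDiag (uniformizerAt w) i)⁻¹ * (localComponent n K w l')⁻¹ * cutDiag (uniformizerAt w) i := by
        group
      rw [hinv]
      refine hl'w.2.cutDiag_conj hϖ1 (topRightDivisible_of_le_one ?_)
      rw [← hinv]
      exact hcw.2.le_one
    · rw [map_mul, map_mul, map_inv, localComponent_heckeElement_ne hwv, inv_one, one_mul, mul_one]
      exact hl'.2 w hw

variable (𝒰) in
/-- **`U_{v,i}` acts level-compatibly on the Hida tower** (`v ∣ p`, `U` maximal above `p`): the
finite-level operators `[U(r) t_{v,i} U(r)]` commute with the pull-backs `H^•(X_{U(r)}) →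
H^•(X_{U(r')})`, `r ≤ r'` [cite: KhareThorne2017, §6.2, Lemma 6.5 (2)]. -/
theorem isTowerCompatible_heckeElement_of_mem (k : Type) [CommRing k] (h𝒰 : 𝒰.IsMaximalAbove)
    {v : HeightOneSpectrum (𝓞 K)} (hv : (p : 𝓞 K) ∈ v.asIdeal) (i : ℕ) :
    IsTowerCompatible k (globalEmbedding n K) 𝒰.hidaTower (p : k) (heckeElement n K v i) :=
  isTowerCompatible_of_bijOn k (globalEmbedding n K) 𝒰.hidaTower (p : k) _
    (fun h => bijOn_hidaLevel_heckeElement_of_mem h𝒰 hv i h)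
    fun r => finite_orbit_quotient (𝒰.hidaLevel r) _

/-- Conjugation by a diamond element `⟨u⟩_v`, `v ∣ p`, preserves every Hida level (`U` maximal above
`p`): `T_n(𝒪_v)` normalises `Iw_v(b,c)`. [folklore] -/
theorem diamondElement_conj_mem_hidaLevel (h𝒰 : 𝒰.IsMaximalAbove) {v : HeightOneSpectrum (𝓞 K)}
    (hv : (p : 𝓞 K) ∈ v.asIdeal) (u : Fin n → (v.adicCompletionIntegers K)ˣ) (r : ℕ)
    {x : FiniteAdelicGL n K} (hx : x ∈ 𝒰.hidaLevel r) :
    (diamondElement n K v u)⁻¹ * x * diamondElement n K v u ∈ 𝒰.hidaLevel r := by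
  have hd : ∀ j, Valued.v ((unitsToLocal n v u j : (v.adicCompletion K)ˣ) : v.adicCompletion K) = 1 :=
    valued_unitsToLocal v u
  have hdU : diamondElement n K v u ∈ 𝒰.subgroup :=
    h𝒰.ofLocal_mem v hv _ (glDiagonal_mem_valuedCongruenceSubgroup_one_of_eq_one hd)
  rw [mem_hidaLevel_iff] at hx ⊢
  refine ⟨mul_mem (mul_mem (inv_mem hdU) hx.1) hdU, fun w hw => ?_⟩
  rw [map_mul, map_mul, map_inv, diamondElement_apply]
  by_cases hwv : w = v
  · subst hwv
    rw [localComponent_ofLocal]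
    exact glDiagonal_conj_mem_valuedIwahoriSubgroup hd (hx.2 w hw)
  · rw [localComponent_ofLocal_of_ne hwv, inv_one, one_mul, mul_one]
    exact hx.2 w hw

variable (𝒰) in
/-- **The diamond elements `⟨u⟩_v`, `v ∣ p`, act level-compatibly on the Hida tower** (`U` maximal
above `p`). [cite: KhareThorne2017, §6.2, Lemma 6.5 (2)] -/
theorem isTowerCompatible_diamondElement (k : Type) [CommRing k] (h𝒰 : 𝒰.IsMaximalAbove)
    {v : HeightOneSpectrum (𝓞 K)} (hv : (p : 𝓞 K) ∈ v.asIdeal) (u : Fin n → (v.adicCompletionIntegers K)ˣ) :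
    IsTowerCompatible k (globalEmbedding n K) 𝒰.hidaTower (p : k) (diamondElement n K v u) :=
  𝒰.isTowerCompatible_of_conj k fun r _ hx => diamondElement_conj_mem_hidaLevel h𝒰 hv u r hx

end TameLevel

end BigHeckeGLn

/-! ### The Hecke operators of the Hida tower: finite levels, the big algebra, ordinary parts -/

namespace BigHeckeGLn

namespace TameLevel

variable {n : ℕ} {K : Type} [Field K] [NumberField K] {p : ℕ} [Fact p.Prime]
  (𝒰 : TameLevel n K p) (k : Type) [CommRing k]

/-- The places whose Hecke operators enter the Hida Hecke algebra: the good places `w ∉ S`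
(spherical operators `T_{w,j}`) and the places above `p` (operators `U_{v,j}`, `⟨u⟩_v`).
[folklore] -/
def IsHidaPlace (w : HeightOneSpectrum (𝓞 K)) : Prop :=
  w ∉ 𝒰.bad ∨ (p : 𝓞 K) ∈ w.asIdeal

/-- **The Hecke elements of the Hida tower**: `t_{w,j}` and `t_{w,n}⁻¹` at the Hida places `w`
(`w ∉ S`: the spherical `T_{w,j}`; `w ∣ p`: the `U_{w,j}`), and the diamond elements `⟨u⟩_v`,
`u ∈ T_n(𝒪_v)`, `v ∣ p` — generators of `𝕋^S ⊗ ℤ[T_n(𝒪_{K,p})][U_{v,j}, U_{v,n}^{±1}]`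
[cite: AllenCalegariCaraianiGeeEtAl2023, §5.1 (definition of 𝕋^{S,ord})]. -/
def hidaElements : Set (FiniteAdelicGL n K) :=
  {g | ∃ w, 𝒰.IsHidaPlace w ∧ ∃ j : ℕ, g = heckeElement n K w j} ∪
    {g | ∃ w, 𝒰.IsHidaPlace w ∧ g = (heckeElement n K w n)⁻¹} ∪
      {g | ∃ v : HeightOneSpectrum (𝓞 K), ∃ _ : (p : 𝓞 K) ∈ v.asIdeal,
        ∃ u : Fin n → (v.adicCompletionIntegers K)ˣ, g = diamondElement n K v u}

/-- `t_{w,j}` is a Hida element for a Hida place `w`. [folklore] -/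
theorem heckeElement_mem_hidaElements {w : HeightOneSpectrum (𝓞 K)} (hw : 𝒰.IsHidaPlace w) (j : ℕ) :
    heckeElement n K w j ∈ 𝒰.hidaElements :=
  Or.inl (Or.inl ⟨w, hw, j, rfl⟩)

/-- `t_{w,n}⁻¹` is a Hida element for a Hida place `w`. [folklore] -/
theorem heckeElement_inv_mem_hidaElements {w : HeightOneSpectrum (𝓞 K)} (hw : 𝒰.IsHidaPlace w) :
    (heckeElement n K w n)⁻¹ ∈ 𝒰.hidaElements :=
  Or.inl (Or.inr ⟨w, hw, rfl⟩)

/-- `⟨u⟩_v` is a Hida element for `v ∣ p`. [folklore] -/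
theorem diamondElement_mem_hidaElements {v : HeightOneSpectrum (𝓞 K)} (hv : (p : 𝓞 K) ∈ v.asIdeal)
    (u : Fin n → (v.adicCompletionIntegers K)ˣ) : diamondElement n K v u ∈ 𝒰.hidaElements :=
  Or.inr ⟨v, hv, u, rfl⟩

/-- **Every Hecke element of the Hida tower acts level-compatibly** (for `U` maximal above `p`),
hence on the completed cohomology of the Hida tower (`completedHecke`). [cite: KhareThorne2017, §6.2, Lemma 6.5] -/
theorem isTowerCompatible_of_mem_hidaElements (h𝒰 : 𝒰.IsMaximalAbove) {g : FiniteAdelicGL n K}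
    (hg : g ∈ 𝒰.hidaElements) : IsTowerCompatible k (globalEmbedding n K) 𝒰.hidaTower (p : k) g := by
  rcases hg with (⟨w, hw, j, rfl⟩ | ⟨w, hw, rfl⟩) | ⟨v, hv, u, rfl⟩
  · rcases hw with hw | hw
    · exact 𝒰.isTowerCompatible_heckeElement_of_not_mem k hw j
    · exact 𝒰.isTowerCompatible_heckeElement_of_mem k h𝒰 hw j
  · exact 𝒰.isTowerCompatible_heckeElement_self_inv k w
  · exact 𝒰.isTowerCompatible_diamondElement k h𝒰 hv u

/-- `H^i(X_{U(r)}, k/p^s)`, the cohomology of the Hida level `U(r)` with `p^s`-torsion coefficients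
(the generic `towerCohomology` of the Hida tower), at the index `x = (i, r, s)`. [folklore] -/
abbrev hidaCohomology (x : TowerIndex) : ModuleCat k :=
  towerCohomology k (globalEmbedding n K) 𝒰.hidaTower (p : k) x.1 x.2.1 x.2.2

/-- The factor `End_k H^i(X_{U(r)}, k/p^s)` at `x = (i, r, s)`, a ring with the DISCRETE topology.
[folklore] -/
def HidaEndFactor (x : TowerIndex) : Type :=
  Module.End k (𝒰.hidaCohomology k x)

/-- Ring structure of the factor (that of `Module.End`). [folklore] -/
instance (x : TowerIndex) : Ring (𝒰.HidaEndFactor k x) := inferInstanceAs (Ring (Module.End k _))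

/-- Elements of the factor are functions (the `FunLike` structure of `Module.End`). [folklore] -/
instance (x : TowerIndex) : FunLike (𝒰.HidaEndFactor k x) (𝒰.hidaCohomology k x) (𝒰.hidaCohomology k x) :=
  inferInstanceAs (FunLike (Module.End k _) _ _)

/-- Elements of the factor as `k`-linear endomorphisms (the identity map). [folklore] -/
abbrev HidaEndFactor.toEnd {x : TowerIndex} (T : 𝒰.HidaEndFactor k x) :
    Module.End k (𝒰.hidaCohomology k x) := T

/-- The discrete topology on each factor. [folklore] -/
instance (x : TowerIndex) : TopologicalSpace (𝒰.HidaEndFactor k x) := ⊥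

/-- Each factor is discrete (by definition). [folklore] -/
instance (x : TowerIndex) : DiscreteTopology (𝒰.HidaEndFactor k x) := ⟨rfl⟩

/-- The product topological ring `∏_{(i,r,s)} End_k H^i(X_{U(r)}, k/p^s)` (product of discrete
rings). [folklore] -/
abbrev hidaEndProd : Type := ∀ x : TowerIndex, 𝒰.HidaEndFactor k x

/-- The diagonal family `([U(r) g U(r)] on H^i(X_{U(r)}, k/p^s))_{(i,r,s)}` of Hecke operators of `g`
along the Hida tower (the generic `towerHeckeFamily`). [folklore] -/
def hidaFamily (g : FiniteAdelicGL n K) : 𝒰.hidaEndProd k := fun x =>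
  show 𝒰.HidaEndFactor k x from towerHeckeFamily k (globalEmbedding n K) 𝒰.hidaTower (p : k) g x

/-- Unfolding `hidaFamily` at an index: the finite-level operator `[U(r) g U(r)]` on
`H^i(X_{U(r)}, k/p^s)`. [folklore] -/
theorem hidaFamily_apply (g : FiniteAdelicGL n K) (x : TowerIndex) :
    𝒰.hidaFamily k g x = ArithmeticQuotient.heckeEnd k (𝒰.hidaLevel x.2.1) g (modPow k (p : k) x.2.2)
      (globalEmbedding n K) x.1 :=
  rfl

/-- The generating families of the Hida Hecke algebra: the operators of the Hida elements. [folklore] -/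
def hidaGenerators : Set (𝒰.hidaEndProd k) :=
  𝒰.hidaFamily k '' 𝒰.hidaElements

/-- **The big Hecke algebra of the Hida tower `𝕋^{S}(𝒰; p)_k`** ("𝕋^{S,ord} before taking ordinary
parts"): the closure of the subring of `∏_{(i,r,s)} End_k H^i(X_{U(r)}, k/p^s)` generated by the
operators `T_{w,j}, T_{w,n}⁻¹` (`w ∉ S`), `U_{v,j}, U_{v,n}⁻¹` and `⟨u⟩_v` (`v ∣ p`) — the image
of the abstract `𝕋^{S,ord} = 𝕋^S ⊗ ℤ[T_n(𝒪_{K,p})][U_{v,j}, U_{v,n}^{±1}]` of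
[cite: AllenCalegariCaraianiGeeEtAl2023, §5.1] acting on all `H^i(X_{K(b,c)}, k/p^s)` at once,
completed for the product of the discrete topologies (as `bigHeckeSubring` for `𝕋(K^p)`). -/
def hidaHeckeSubring : Subring (𝒰.hidaEndProd k) :=
  (Subring.closure (𝒰.hidaGenerators k)).topologicalClosure

/-- The **finite-level Hida Hecke algebra** at `x = (i, r, s)`: the subring of
`End_k H^i(X_{U(r)}, k/p^s)` generated by the `x`-components of the generators (the image
`𝕋^S(K(0,c)/K(b,c), ·)` → `End` of [cite: AllenCalegariCaraianiGeeEtAl2023, §5.1]). -/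
def hidaLevelSubring (x : TowerIndex) : Subring (𝒰.HidaEndFactor k x) :=
  Subring.closure ((fun T : 𝒰.hidaEndProd k => T x) '' 𝒰.hidaGenerators k)

/-- The components of a generating family lie in the finite-level algebras. [folklore] -/
theorem hidaFamily_apply_mem_hidaLevelSubring {g : FiniteAdelicGL n K} (hg : g ∈ 𝒰.hidaElements)
    (x : TowerIndex) : 𝒰.hidaFamily k g x ∈ 𝒰.hidaLevelSubring k x :=
  Subring.subset_closure ⟨_, ⟨g, hg, rfl⟩, rfl⟩

/-- The families all of whose components lie in the finite-level algebras form a closed subring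
containing the generators, hence containing `hidaHeckeSubring`. [folklore] -/
def levelwiseSubring : Subring (𝒰.hidaEndProd k) where
  carrier := {T | ∀ x, T x ∈ 𝒰.hidaLevelSubring k x}
  mul_mem' ha hb x := mul_mem (ha x) (hb x)
  one_mem' _ := one_mem _
  add_mem' ha hb x := add_mem (ha x) (hb x)
  zero_mem' _ := zero_mem _
  neg_mem' ha x := neg_mem (ha x)

/-- `levelwiseSubring` is closed (each condition involves one discrete coordinate). [folklore] -/
theorem isClosed_levelwiseSubring : IsClosed (𝒰.levelwiseSubring k : Set (𝒰.hidaEndProd k)) := by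
  have : (𝒰.levelwiseSubring k : Set (𝒰.hidaEndProd k)) =
      ⋂ x, (fun T : 𝒰.hidaEndProd k => T x) ⁻¹' (𝒰.hidaLevelSubring k x : Set (𝒰.HidaEndFactor k x)) := by
    ext T; simp [levelwiseSubring]
  rw [this]
  exact isClosed_iInter fun x => (isClosed_discrete _).preimage (continuous_apply x)

/-- Every element of `𝕋^S(𝒰; p)` has all its components in the finite-level algebras. [folklore] -/
theorem hidaHeckeSubring_le_levelwiseSubring : 𝒰.hidaHeckeSubring k ≤ 𝒰.levelwiseSubring k :=
  Subring.topologicalClosure_minimal _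
    (Subring.closure_le.2 (by rintro _ ⟨g, hg, rfl⟩ x; exact 𝒰.hidaFamily_apply_mem_hidaLevelSubring k hg x))
    (𝒰.isClosed_levelwiseSubring k)

/-! ### Ordinary parts at finite level -/

/-- The `k`-span of `𝕋_x · U^m(H)` for an operator `U` at the index `x`: spanned by the
`T (U^m y)`, `T ∈ hidaLevelSubring x` (equal to `U^m(H)` as soon as `U` commutes with the
finite-level algebra). [folklore] -/
def ordSpan (x : TowerIndex) (U : 𝒰.HidaEndFactor k x) (m : ℕ) : Submodule k (𝒰.hidaCohomology k x) :=
  Submodule.span k {y | ∃ T ∈ 𝒰.hidaLevelSubring k x, ∃ z, y = T ((U ^ m) z)}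

/-- `𝕋_x · U^m(H)` is stable under `𝕋_x`. [folklore] -/
theorem apply_mem_ordSpan {x : TowerIndex} {T : 𝒰.HidaEndFactor k x} (hT : T ∈ 𝒰.hidaLevelSubring k x)
    (U : 𝒰.HidaEndFactor k x) (m : ℕ) {y : 𝒰.hidaCohomology k x} (hy : y ∈ 𝒰.ordSpan k x U m) :
    T y ∈ 𝒰.ordSpan k x U m := by
  have : (𝒰.ordSpan k x U m).map (HidaEndFactor.toEnd 𝒰 k T) ≤ 𝒰.ordSpan k x U m := by
    refine (Submodule.map_span_le _ _ _).2 ?_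
    rintro _ ⟨T', hT', z, rfl⟩
    exact Submodule.subset_span ⟨T * T', mul_mem hT hT', z, rfl⟩
  exact this ⟨y, hy, rfl⟩

/-- **The ordinary part `H^i(X_{U(r)}, k/p^s)^{ord}`** at `x = (i, r, s)`: the intersection over
`v ∣ p`, `1 ≤ j ≤ n - 1` and `m ≥ 0` of `𝕋_x · U_{v,j}^m (H)` — the largest `𝕋_x`-stable submodule
on which every `U_{v,j}` is "infinitely divisible".  When `H` is a finite `k`-module and the
operators commute this is `e H` for Hida's idempotent `e = lim_m U_p^{m!}`,
`U_p = ∏_{v ∣ p} ∏_{j=1}^{n-1} U_{v,j}` (`range_eq_iInf_range_pow_of_forall_pow_factorial_eq`,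
`exists_isIdempotentElem_forall_pow_factorial_eq`), i.e. the ordinary part `M_{ord}` of
[cite: KhareThorne2017, §2.4, Lemma 2.10] = the maximal direct summand on which `U_p` acts
invertibly [cite: AllenCalegariCaraianiGeeEtAl2023, §5.1]; the definition itself is
existence-free. -/
def ordinaryPart (x : TowerIndex) : Submodule k (𝒰.hidaCohomology k x) :=
  ⨅ (v : {v : HeightOneSpectrum (𝓞 K) // (p : 𝓞 K) ∈ v.asIdeal}) (j : Fin (n - 1)) (m : ℕ),
    𝒰.ordSpan k x (𝒰.hidaFamily k (heckeElement n K v.1 (j.val + 1)) x) m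

/-- The ordinary part is stable under the finite-level Hida Hecke algebra. [folklore] -/
theorem apply_mem_ordinaryPart {x : TowerIndex} {T : 𝒰.HidaEndFactor k x}
    (hT : T ∈ 𝒰.hidaLevelSubring k x) {y : 𝒰.hidaCohomology k x} (hy : y ∈ 𝒰.ordinaryPart k x) :
    T y ∈ 𝒰.ordinaryPart k x := by
  simp only [ordinaryPart, Submodule.mem_iInf] at hy ⊢
  exact fun v j m => 𝒰.apply_mem_ordSpan k hT _ m (hy v j m)

/-- For an operator `U` commuting with the finite-level algebra, `𝕋_x · U^m(H) = U^m(H)`. [folklore] -/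
theorem ordSpan_eq_range {x : TowerIndex} {U : 𝒰.HidaEndFactor k x}
    (hcomm : ∀ T ∈ 𝒰.hidaLevelSubring k x, Commute T U) (m : ℕ) :
    𝒰.ordSpan k x U m = LinearMap.range (HidaEndFactor.toEnd 𝒰 k (U ^ m)) := by
  refine le_antisymm (Submodule.span_le.2 ?_) fun y hy => ?_
  · rintro _ ⟨T, hT, z, rfl⟩
    refine ⟨T z, ?_⟩
    change (U ^ m * T) z = (T * U ^ m) z
    rw [((hcomm T hT).pow_right m).eq]
  · obtain ⟨z, rfl⟩ := hy
    exact Submodule.subset_span ⟨1, one_mem _, z, rfl⟩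

/-- **Finite case: the ordinary part of one operator is the range of Hida's idempotent.** If `U`
commutes with the finite-level algebra and `U^{m!} = e` for all large `m` (which holds for SOME
idempotent `e` whenever `H^i(X_{U(r)}, k/p^s)` is finite, `exists_isIdempotentElem_forall_pow_factorial_eq`),
then `⋂_m 𝕋_x · U^m(H) = e H` [cite: KhareThorne2017, §2.4, Lemma 2.10]. -/
theorem iInf_ordSpan_eq_range {x : TowerIndex} {U e : 𝒰.HidaEndFactor k x}
    (hcomm : ∀ T ∈ 𝒰.hidaLevelSubring k x, Commute T U) {N : ℕ}
    (he : ∀ m, N ≤ m → U ^ m.factorial = e) :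
    ⨅ m, 𝒰.ordSpan k x U m = LinearMap.range (HidaEndFactor.toEnd 𝒰 k e) := by
  simp_rw [𝒰.ordSpan_eq_range k hcomm]
  exact (range_eq_iInf_range_pow_of_forall_pow_factorial_eq he).symm

/-! ### The ordinary big Hecke algebra `𝕋^{S,ord}(𝒰)` -/

/-- The factor `End_k(H^i(X_{U(r)}, k/p^s)^{ord})` at `x = (i, r, s)`, with the DISCRETE topology.
[folklore] -/
def OrdEndFactor (x : TowerIndex) : Type :=
  Module.End k (𝒰.ordinaryPart k x)

/-- Ring structure of the ordinary factor (that of `Module.End`). [folklore] -/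
instance (x : TowerIndex) : Ring (𝒰.OrdEndFactor k x) := inferInstanceAs (Ring (Module.End k _))

/-- Elements of the ordinary factor are functions. [folklore] -/
instance (x : TowerIndex) : FunLike (𝒰.OrdEndFactor k x) (𝒰.ordinaryPart k x) (𝒰.ordinaryPart k x) :=
  inferInstanceAs (FunLike (Module.End k _) _ _)

/-- The discrete topology on each ordinary factor. [folklore] -/
instance (x : TowerIndex) : TopologicalSpace (𝒰.OrdEndFactor k x) := ⊥

/-- Each ordinary factor is discrete (by definition). [folklore] -/
instance (x : TowerIndex) : DiscreteTopology (𝒰.OrdEndFactor k x) := ⟨rfl⟩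

/-- The product topological ring `∏_{(i,r,s)} End_k(H^i(X_{U(r)}, k/p^s)^{ord})`. [folklore] -/
abbrev ordEndProd : Type := ∀ x : TowerIndex, 𝒰.OrdEndFactor k x

/-- Restriction of the finite-level Hida Hecke algebra to the ordinary part (a ring homomorphism
`𝕋_x → End(H^{ord})`). [folklore] -/
def restrictOrd (x : TowerIndex) : 𝒰.hidaLevelSubring k x →+* 𝒰.OrdEndFactor k x where
  toFun T := (HidaEndFactor.toEnd 𝒰 k T.1).restrict fun _ hy => 𝒰.apply_mem_ordinaryPart k T.2 hy
  map_one' := LinearMap.ext fun _ => Subtype.ext rfl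
  map_mul' _ _ := LinearMap.ext fun _ => Subtype.ext rfl
  map_zero' := LinearMap.ext fun _ => Subtype.ext rfl
  map_add' _ _ := LinearMap.ext fun _ => Subtype.ext rfl

/-- Unfolding `restrictOrd` on an element of the ordinary part. [folklore] -/
@[simp]
theorem restrictOrd_apply_coe (x : TowerIndex) (T : 𝒰.hidaLevelSubring k x) (y : 𝒰.ordinaryPart k x) :
    ((𝒰.restrictOrd k x T : 𝒰.OrdEndFactor k x) y : 𝒰.hidaCohomology k x) =
      (T.1 : 𝒰.HidaEndFactor k x) (y : 𝒰.hidaCohomology k x) :=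
  rfl

/-- Levelwise restriction to the ordinary parts: a continuous ring homomorphism
`levelwiseSubring → ∏ End(H^{ord})`. [folklore] -/
def restrictOrdAll : 𝒰.levelwiseSubring k →+* 𝒰.ordEndProd k where
  toFun T x := 𝒰.restrictOrd k x ⟨T.1 x, T.2 x⟩
  map_one' := funext fun x => (𝒰.restrictOrd k x).map_one
  map_mul' a b := funext fun x => (𝒰.restrictOrd k x).map_mul ⟨a.1 x, a.2 x⟩ ⟨b.1 x, b.2 x⟩
  map_zero' := funext fun x => (𝒰.restrictOrd k x).map_zero
  map_add' a b := funext fun x => (𝒰.restrictOrd k x).map_add ⟨a.1 x, a.2 x⟩ ⟨b.1 x, b.2 x⟩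

/-- `restrictOrdAll` is continuous (each component factors through one discrete coordinate).
[folklore] -/
theorem continuous_restrictOrdAll : Continuous (𝒰.restrictOrdAll k) := by
  refine continuous_pi fun x => ?_
  have h1 : Continuous fun T : 𝒰.levelwiseSubring k => (⟨T.1 x, T.2 x⟩ : 𝒰.hidaLevelSubring k x) :=
    ((continuous_apply x).comp continuous_subtype_val).subtype_mk _
  exact (continuous_of_discreteTopology (f := 𝒰.restrictOrd k x)).comp h1

/-- The ordinary family of a Hida element: its finite-level operators restricted to the ordinary
parts. [folklore] -/
def ordFamily {g : FiniteAdelicGL n K} (hg : g ∈ 𝒰.hidaElements) : 𝒰.ordEndProd k :=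
  𝒰.restrictOrdAll k ⟨𝒰.hidaFamily k g, fun x => 𝒰.hidaFamily_apply_mem_hidaLevelSubring k hg x⟩

/-- The generating families of the ordinary Hecke algebra: the ordinary families of the Hida elements.
[folklore] -/
def ordGenerators : Set (𝒰.ordEndProd k) :=
  {T | ∃ g, ∃ hg : g ∈ 𝒰.hidaElements, T = 𝒰.ordFamily k hg}

/-- **The ordinary big Hecke algebra `𝕋^{S,ord}(𝒰)_k`**: the closure of the subring of
`∏_{(i,r,s)} End_k(H^i(X_{U(r)}, k/p^s)^{ord})` generated by the restrictions to the ordinary parts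
of the operators `T_{w,j}, T_{w,n}⁻¹` (`w ∉ S`), `U_{v,j}, U_{v,n}⁻¹`, `⟨u⟩_v` (`v ∣ p`) — the inverse
limit over `(b, c, s)` of the ordinary Hecke algebras
`𝕋^S(K(b,c), k/p^s)^{ord} = im(𝕋^{S,ord} → End(H^•(X_{K(b,c)}, k/p^s)^{ord}))` of
[cite: AllenCalegariCaraianiGeeEtAl2023, §5.1] (trivial weight `λ = 0`), i.e. Hida's big
(nearly) ordinary Hecke algebra acting faithfully on `⊕ H^•(X_{U(r)}, k/p^s)^{ord}`
([cite: KhareThorne2017, §6.5 (𝕋^S_ord(U))], homological form; Hida's universal nearly ordinary Hecke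
algebra for `GL_2` over a number field, Duke Math. J. 69 (1993)). A closed subring of a product of
discrete rings: a Hausdorff topological ring. -/
def ordHeckeSubring : Subring (𝒰.ordEndProd k) :=
  (Subring.closure (𝒰.ordGenerators k)).topologicalClosure

/-- The ordinary family of a Hida element lies in `𝕋^{S,ord}(𝒰)`. [folklore] -/
theorem ordFamily_mem_ordHeckeSubring {g : FiniteAdelicGL n K} (hg : g ∈ 𝒰.hidaElements) :
    𝒰.ordFamily k hg ∈ 𝒰.ordHeckeSubring k :=
  (Subring.closure _).le_topologicalClosure (Subring.subset_closure ⟨g, hg, rfl⟩)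

/-- The family of a Hida element lies in `𝕋^S(𝒰; p)`. [folklore] -/
theorem hidaFamily_mem_hidaHeckeSubring {g : FiniteAdelicGL n K} (hg : g ∈ 𝒰.hidaElements) :
    𝒰.hidaFamily k g ∈ 𝒰.hidaHeckeSubring k :=
  (Subring.closure _).le_topologicalClosure (Subring.subset_closure ⟨g, hg, rfl⟩)

/-- **`𝕋^{S}(𝒰; p) → 𝕋^{S,ord}(𝒰)`**, restriction to the ordinary parts: a continuous ring
homomorphism (with dense image) — the passage to the ordinary quotient `e 𝕋` of Hida theory.
[folklore] -/
def toOrd : 𝒰.hidaHeckeSubring k →+* 𝒰.ordHeckeSubring k :=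
  ((𝒰.restrictOrdAll k).comp (Subring.inclusion (𝒰.hidaHeckeSubring_le_levelwiseSubring k))).codRestrict _
    (by
      -- the subring of `levelwiseSubring` mapping into `ordHeckeSubring` is closed and contains the
      -- generators, hence contains `hidaHeckeSubring`
      have hB : 𝒰.hidaHeckeSubring k ≤ ((𝒰.ordHeckeSubring k).comap (𝒰.restrictOrdAll k)).map
          (𝒰.levelwiseSubring k).subtype := by
        refine Subring.topologicalClosure_minimal _ (Subring.closure_le.2 ?_) ?_
        · rintro _ ⟨g, hg, rfl⟩
          exact ⟨⟨𝒰.hidaFamily k g, fun x => 𝒰.hidaFamily_apply_mem_hidaLevelSubring k hg x⟩,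
            𝒰.ordFamily_mem_ordHeckeSubring k hg, rfl⟩
        · change IsClosed (Subtype.val '' ((𝒰.restrictOrdAll k) ⁻¹' (𝒰.ordHeckeSubring k : Set _)))
          exact (𝒰.isClosed_levelwiseSubring k).isClosedMap_subtype_val _
            ((Subring.isClosed_topologicalClosure _).preimage (𝒰.continuous_restrictOrdAll k))
      intro T
      obtain ⟨T', hT', hTT'⟩ := hB T.2
      have : Subring.inclusion (𝒰.hidaHeckeSubring_le_levelwiseSubring k) T = T' :=
        Subtype.ext hTT'.symm
      rw [RingHom.comp_apply, this]
      exact hT')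

/-- `toOrd` is continuous. [folklore] -/
theorem continuous_toOrd : Continuous (𝒰.toOrd k) :=
  ((𝒰.continuous_restrictOrdAll k).comp (continuous_subtype_val.subtype_mk _)).subtype_mk _

end TameLevel

end BigHeckeGLn

/-! ### Ordinary completed cohomology of the Hida tower -/

namespace BigHeckeGLn

namespace TameLevel

variable {n : ℕ} {K : Type} [Field K] [NumberField K] {p : ℕ} [Fact p.Prime]
  (𝒰 : TameLevel n K p) (k : Type) [CommRing k]

/-- The finite stage `H̃^i_{Hida}(k/p^t) = colim_r H^i(X_{U(r)}, k/p^t)` of the completed cohomology of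
the Hida tower. [folklore] -/
abbrev hidaCompletedCohomologyMod (i t : ℕ) : Type :=
  completedCohomologyMod k (globalEmbedding n K) 𝒰.hidaTower (p : k) i t

/-- **The completed cohomology of the Hida tower** `H̃^i_{Hida} := lim_t colim_r H^i(X_{U(r)}, k/p^t)`
(the generic `completedCohomology` for the Hida tower; Hida's `lim_→ H^i(X_{U_1(p^r)})` completed
`p`-adically — the object carrying Hida's big nearly ordinary Hecke algebra (Hida, Duke Math. J. 69
(1993), for `GL_2` over number fields); NOT Emerton's `H̃^i` of the full `p`-power tower,
`TameLevel.completedCohomology`). [cite: KhareThorne2017, §6.3] -/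
abbrev hidaCompletedCohomology (i : ℕ) : Submodule k (∀ t, 𝒰.hidaCompletedCohomologyMod k i t) :=
  completedCohomology k (globalEmbedding n K) 𝒰.hidaTower (p : k) i

/-- **The ordinary part of `H̃^i_{Hida}(k/p^t)`**: the union (supremum) over the levels `r` of the
images of the finite-level ordinary parts `H^i(X_{U(r)}, k/p^t)^{ord}` — equal to
`e · H̃^i_{Hida}(k/p^t) = colim_r e H^i(X_{U(r)}, k/p^t)` when Hida's idempotents exist compatibly
([cite: KhareThorne2017, §6.3], cohomological form). [folklore] -/
def ordinaryPartMod (i t : ℕ) : Submodule k (𝒰.hidaCompletedCohomologyMod k i t) :=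
  ⨆ r : ℕ, (𝒰.ordinaryPart k (i, r, t)).map
    (toCompletedCohomologyMod k (globalEmbedding n K) 𝒰.hidaTower (p : k) i r t)

/-- The image of a finite-level ordinary part lies in the ordinary part of the finite stage.
[folklore] -/
theorem map_ordinaryPart_le_ordinaryPartMod (i r t : ℕ) :
    (𝒰.ordinaryPart k (i, r, t)).map
      (toCompletedCohomologyMod k (globalEmbedding n K) 𝒰.hidaTower (p : k) i r t) ≤
        𝒰.ordinaryPartMod k i t :=
  le_iSup (fun r : ℕ => (𝒰.ordinaryPart k (i, r, t)).map
    (toCompletedCohomologyMod k (globalEmbedding n K) 𝒰.hidaTower (p : k) i r t)) r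

/-- **Hida's ordinary completed cohomology `H̃^{i,ord}(𝒰)_k = e · H̃^i_{Hida}`**: the compatible
sequences in `lim_t colim_r H^i(X_{U(r)}, k/p^t)` all of whose stages are ordinary — the
cohomological, `GL_n`-version of the ordinary completed (co)homology
`H^i_{ord}(U) = lim_c H_{d-i}(X_{U(c,c)}, 𝒪/ϖ^c)_{ord}` of [cite: KhareThorne2017, §6.3] (Hida's
`e · lim_→ H^i` for `GL_2`, Duke Math. J. 69 (1993)). -/
def ordinaryCompletedCohomology (i : ℕ) : Submodule k (∀ t, 𝒰.hidaCompletedCohomologyMod k i t) :=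
  𝒰.hidaCompletedCohomology k i ⊓ Submodule.pi Set.univ fun t => 𝒰.ordinaryPartMod k i t

/-- `H̃^{i,ord} ≤ H̃^i_{Hida}`. [folklore] -/
theorem ordinaryCompletedCohomology_le (i : ℕ) :
    𝒰.ordinaryCompletedCohomology k i ≤ 𝒰.hidaCompletedCohomology k i :=
  inf_le_left

/-- Membership in `H̃^{i,ord}`: a compatible sequence all of whose stages are ordinary. [folklore] -/
theorem mem_ordinaryCompletedCohomology_iff (i : ℕ) (x : ∀ t, 𝒰.hidaCompletedCohomologyMod k i t) :
    x ∈ 𝒰.ordinaryCompletedCohomology k i ↔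
      x ∈ 𝒰.hidaCompletedCohomology k i ∧ ∀ t, x t ∈ 𝒰.ordinaryPartMod k i t := by
  simp [ordinaryCompletedCohomology, Submodule.mem_pi]

/-- **The Hecke operators `T_{w,j}`, `U_{v,j}`, `⟨u⟩_v` on the completed cohomology of the Hida
tower** (`U` maximal above `p`): the compatible family of the finite-level operators, `completedHecke`
applied to the level-compatibility `isTowerCompatible_of_mem_hidaElements`
[cite: KhareThorne2017, §6.3 ("the natural maps … commute with the action of the Hecke operator U_p")]. -/
def completedHidaHecke (h𝒰 : 𝒰.IsMaximalAbove) {g : FiniteAdelicGL n K} (hg : g ∈ 𝒰.hidaElements)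
    (i : ℕ) : Module.End k (𝒰.hidaCompletedCohomology k i) :=
  completedHecke (𝒰.isTowerCompatible_of_mem_hidaElements k h𝒰 hg) i

end TameLevel

end BigHeckeGLn

open BigHeckeGLn

/-- **The Hecke algebra of the Hida tower `𝕋^S(𝒰; p)`** of `GL_n / K` of tame level `𝒰` (with
`ℤ/p^s`-coefficients): the closed subring of `∏ End(H^i(X_{U(r)}, ℤ/p^s))` topologically generated by
`T_{w,j}, T_{w,n}⁻¹` (`w ∉ S`), `U_{v,j}, U_{v,n}⁻¹`, `⟨u⟩_v` (`v ∣ p`) — the completed image of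
`𝕋^{S,ord} = 𝕋^S ⊗ ℤ[T_n(𝒪_{K,p})][U_{v,j}, U_{v,n}^{±1}]` [cite: AllenCalegariCaraianiGeeEtAl2023, §5.1]
BEFORE passing to ordinary parts (`TameLevel.hidaHeckeSubring`). -/
abbrev HidaHeckeAlgebraGLn {n : ℕ} {K : Type} [Field K] [NumberField K] {p : ℕ} [Fact p.Prime]
    (𝒰 : TameLevel n K p) : Type :=
  𝒰.hidaHeckeSubring ℤ

/-- **The ordinary big Hecke algebra `𝕋^{S,ord}(𝒰)`** of `GL_n / K` of tame level `𝒰`: the closed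
subring of `∏ End(H^i(X_{U(r)}, ℤ/p^s)^{ord})` topologically generated by the Hecke operators of the
Hida tower restricted to the ordinary parts (`TameLevel.ordHeckeSubring`) — `lim 𝕋^S(K(b,c), ℤ/p^s)^{ord}`
[cite: AllenCalegariCaraianiGeeEtAl2023, §5.1], the big ordinary Hecke algebra `𝕋^S_{ord}(U)` of
[cite: KhareThorne2017, §6.5] (Hida's universal nearly ordinary Hecke algebra for `GL_2` over a number
field, Duke Math. J. 69 (1993)). A Hausdorff topological ring. -/
abbrev OrdinaryHeckeAlgebraGLn {n : ℕ} {K : Type} [Field K] [NumberField K] {p : ℕ} [Fact p.Prime]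
    (𝒰 : TameLevel n K p) : Type :=
  𝒰.ordHeckeSubring ℤ

namespace BigHeckeGLn

namespace TameLevel

variable {n : ℕ} {K : Type} [Field K] [NumberField K] {p : ℕ} [Fact p.Prime] (𝒰 : TameLevel n K p)

/-- The element of `𝕋^S(𝒰; p)` given by a Hida element `g`. [folklore] -/
def hidaOp {g : FiniteAdelicGL n K} (hg : g ∈ 𝒰.hidaElements) : HidaHeckeAlgebraGLn 𝒰 :=
  ⟨𝒰.hidaFamily ℤ g, 𝒰.hidaFamily_mem_hidaHeckeSubring ℤ hg⟩

/-- The element of `𝕋^{S,ord}(𝒰)` given by a Hida element `g`. [folklore] -/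
def ordOp {g : FiniteAdelicGL n K} (hg : g ∈ 𝒰.hidaElements) : OrdinaryHeckeAlgebraGLn 𝒰 :=
  ⟨𝒰.ordFamily ℤ hg, 𝒰.ordFamily_mem_ordHeckeSubring ℤ hg⟩

/-- `toOrd` carries the operator of `g` to its ordinary restriction (definitional). [folklore] -/
@[simp]
theorem toOrd_hidaOp {g : FiniteAdelicGL n K} (hg : g ∈ 𝒰.hidaElements) :
    𝒰.toOrd ℤ (𝒰.hidaOp hg) = 𝒰.ordOp hg :=
  rfl

open scoped Classical in
/-- **`T_{w,j} ∈ 𝕋^S(𝒰; p)`** for a Hida place `w` (spherical `T_{w,j}` for `w ∉ S`, the operator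
`U_{w,j} = [U(r) diag(ϖ_w^{(j)}, 1^{(n-j)}) U(r)]` for `w ∣ p`); junk value `0` at the other places.
[cite: AllenCalegariCaraianiGeeEtAl2023, §2.2.2] -/
def hidaT (w : HeightOneSpectrum (𝓞 K)) (j : ℕ) : HidaHeckeAlgebraGLn 𝒰 :=
  if hw : 𝒰.IsHidaPlace w then 𝒰.hidaOp (𝒰.heckeElement_mem_hidaElements hw j) else 0

open scoped Classical in
/-- **`T_{w,j}` (resp. `U_{v,j}`) in the ordinary Hecke algebra `𝕋^{S,ord}(𝒰)`**; junk `0` off the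
Hida places. [cite: AllenCalegariCaraianiGeeEtAl2023, §5.1] -/
def ordT (w : HeightOneSpectrum (𝓞 K)) (j : ℕ) : OrdinaryHeckeAlgebraGLn 𝒰 :=
  if hw : 𝒰.IsHidaPlace w then 𝒰.ordOp (𝒰.heckeElement_mem_hidaElements hw j) else 0

open scoped Classical in
/-- The operator of `t_{w,n}⁻¹` in `𝕋^S(𝒰; p)` (junk `0` off the Hida places). [folklore] -/
def hidaTInv (w : HeightOneSpectrum (𝓞 K)) : HidaHeckeAlgebraGLn 𝒰 :=
  if hw : 𝒰.IsHidaPlace w then 𝒰.hidaOp (𝒰.heckeElement_inv_mem_hidaElements hw) else 0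

open scoped Classical in
/-- The operator of `t_{w,n}⁻¹` in `𝕋^{S,ord}(𝒰)` (junk `0` off the Hida places). [folklore] -/
def ordTInv (w : HeightOneSpectrum (𝓞 K)) : OrdinaryHeckeAlgebraGLn 𝒰 :=
  if hw : 𝒰.IsHidaPlace w then 𝒰.ordOp (𝒰.heckeElement_inv_mem_hidaElements hw) else 0

/-- **The diamond operator `⟨u⟩_v ∈ 𝕋^S(𝒰; p)`**, `v ∣ p`, `u ∈ T_n(𝒪_v)` — through which the
weight algebra `Λ = ℤ_p[[T_n(𝒪_{K,p})]]` acts [cite: AllenCalegariCaraianiGeeEtAl2023, §5.1]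
([cite: KhareThorne2017, §6.3]: `Λ = 𝒪[[T(1)]]`). -/
def hidaDiamond {v : HeightOneSpectrum (𝓞 K)} (hv : (p : 𝓞 K) ∈ v.asIdeal)
    (u : Fin n → (v.adicCompletionIntegers K)ˣ) : HidaHeckeAlgebraGLn 𝒰 :=
  𝒰.hidaOp (𝒰.diamondElement_mem_hidaElements hv u)

/-- **The diamond operator `⟨u⟩_v` in the ordinary Hecke algebra `𝕋^{S,ord}(𝒰)`** (its `Λ`-algebra
structure). [cite: AllenCalegariCaraianiGeeEtAl2023, §5.1] -/
def ordDiamond {v : HeightOneSpectrum (𝓞 K)} (hv : (p : 𝓞 K) ∈ v.asIdeal)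
    (u : Fin n → (v.adicCompletionIntegers K)ˣ) : OrdinaryHeckeAlgebraGLn 𝒰 :=
  𝒰.ordOp (𝒰.diamondElement_mem_hidaElements hv u)

/-- `toOrd T_{w,j} = T_{w,j}`. [folklore] -/
@[simp]
theorem toOrd_hidaT (w : HeightOneSpectrum (𝓞 K)) (j : ℕ) : 𝒰.toOrd ℤ (𝒰.hidaT w j) = 𝒰.ordT w j := by
  classical
  unfold hidaT ordT
  split_ifs
  · rfl
  · exact map_zero _

/-- `toOrd` of the operator of `t_{w,n}⁻¹`. [folklore] -/
@[simp]
theorem toOrd_hidaTInv (w : HeightOneSpectrum (𝓞 K)) : 𝒰.toOrd ℤ (𝒰.hidaTInv w) = 𝒰.ordTInv w := by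
  classical
  unfold hidaTInv ordTInv
  split_ifs
  · rfl
  · exact map_zero _

/-- `toOrd ⟨u⟩_v = ⟨u⟩_v`. [folklore] -/
@[simp]
theorem toOrd_hidaDiamond {v : HeightOneSpectrum (𝓞 K)} (hv : (p : 𝓞 K) ∈ v.asIdeal)
    (u : Fin n → (v.adicCompletionIntegers K)ˣ) :
    𝒰.toOrd ℤ (𝒰.hidaDiamond hv u) = 𝒰.ordDiamond hv u :=
  rfl

/-- Unfolding `hidaT` at a Hida place: the family of the operators `[U(r) t_{w,j} U(r)]`. [folklore] -/
theorem coe_hidaT {w : HeightOneSpectrum (𝓞 K)} (hw : 𝒰.IsHidaPlace w) (j : ℕ) :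
    (𝒰.hidaT w j : 𝒰.hidaEndProd ℤ) = 𝒰.hidaFamily ℤ (heckeElement n K w j) := by
  classical
  rw [hidaT, dif_pos hw]
  rfl

/-! ### Ordinary `p`-adic automorphy -/

/-- `ρ` and the `A`-valued point `x` of the Hida Hecke algebra `𝕋^S(𝒰; p)` are **associated**:
`charpoly ρ(Frob_w) = x(P_w)` and unramified at all `w ∉ S` (arithmetic Frobenius, `IsAssociatedFamily`).
[cite: GeeNewton2020, §3.3, Conj. 3.3.2] -/
def IsHidaAssociated {A : Type*} [CommRing A] [TopologicalSpace A] (x : HidaHeckeAlgebraGLn 𝒰 →+* A)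
    (ρ : Literature.NumberTheory.GaloisRepresentations.FramedGaloisRep K A n) : Prop :=
  IsAssociatedFamily n 𝒰.bad (fun w j => x (𝒰.hidaT w j)) ρ

/-- `ρ` and the `A`-valued point `x` of the ORDINARY Hecke algebra `𝕋^{S,ord}(𝒰)` are associated.
[cite: GeeNewton2020, §3.3, Conj. 3.3.2] -/
def IsOrdAssociated {A : Type*} [CommRing A] [TopologicalSpace A] (x : OrdinaryHeckeAlgebraGLn 𝒰 →+* A)
    (ρ : Literature.NumberTheory.GaloisRepresentations.FramedGaloisRep K A n) : Prop :=
  IsAssociatedFamily n 𝒰.bad (fun w j => x (𝒰.ordT w j)) ρ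

/-- **`ρ` is `p`-adically automorphic of Iwahori type and tame level `𝒰`**: associated with a
CONTINUOUS `A`-valued point of the Hida-tower Hecke algebra `𝕋^S(𝒰; p)` — an eigensystem which is
a `p`-adic limit of Hecke eigensystems (including `U_{v,j}`- and diamond eigenvalues) occurring in
the `H^•(X_{U(r)}, ℤ/p^s)`, with no slope condition (cf. `IsPadicallyAutomorphic` for the full
`p`-power tower). [cite: HansenUniversalEigenvarieties2017, Def. 1.2.1] -/
def IsIwahoriPadicallyAutomorphic {A : Type*} [CommRing A] [TopologicalSpace A]
    (ρ : Literature.NumberTheory.GaloisRepresentations.FramedGaloisRep K A n) : Prop :=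
  ∃ x : HidaHeckeAlgebraGLn 𝒰 →+* A, Continuous x ∧ 𝒰.IsHidaAssociated x ρ

/-- **`ρ` is ORDINARILY `p`-adically automorphic of tame level `𝒰`** (`A = 𝒪_E`, `ℤ̄_p`, `ℚ̄_p`, …):
`ρ` is associated with a CONTINUOUS `A`-valued point of Hida's ordinary big Hecke algebra
`𝕋^{S,ord}(𝒰) = OrdinaryHeckeAlgebraGLn 𝒰` — i.e. with a `p`-adic limit of Hecke eigensystems
occurring in the ORDINARY parts `e H^•(X_{U(r)}, ℤ/p^s)` of the cohomology of the Hida tower (for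
`n = 2`: `ρ` is attached to a `p`-adic point of Hida's universal nearly ordinary Hecke algebra), with
the Hecke–Frobenius polynomial `P_w` normalised as in [cite: KhareThorne2017, §6.5, Conj. 6.18] (=
`heckeFrobPoly`, arithmetic Frobenius); the predicate `IsPadicallyAutomorphic` with `𝕋(K^p)` replaced
by its ordinary counterpart [cite: HansenUniversalEigenvarieties2017, Def. 1.2.1]. -/
def IsOrdinarilyPadicallyAutomorphic {A : Type*} [CommRing A] [TopologicalSpace A]
    (ρ : Literature.NumberTheory.GaloisRepresentations.FramedGaloisRep K A n) : Prop :=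
  ∃ x : OrdinaryHeckeAlgebraGLn 𝒰 →+* A, Continuous x ∧ 𝒰.IsOrdAssociated x ρ

variable {𝒰} in
/-- An ordinarily `p`-adically automorphic `ρ` is `p`-adically automorphic of Iwahori type: compose
the point with `toOrd : 𝕋^S(𝒰; p) → 𝕋^{S,ord}(𝒰)`. [folklore] -/
theorem IsOrdinarilyPadicallyAutomorphic.isIwahoriPadicallyAutomorphic {A : Type*} [CommRing A]
    [TopologicalSpace A] {ρ : Literature.NumberTheory.GaloisRepresentations.FramedGaloisRep K A n}
    (h : 𝒰.IsOrdinarilyPadicallyAutomorphic ρ) : 𝒰.IsIwahoriPadicallyAutomorphic ρ := by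
  obtain ⟨x, hx, hass⟩ := h
  refine ⟨x.comp (𝒰.toOrd ℤ), hx.comp (𝒰.continuous_toOrd ℤ), fun w hw => ?_⟩
  simpa only [RingHom.comp_apply, toOrd_hidaT] using hass w hw

/-- **Slope zero at `v`**: the point `x` of `𝕋^S(𝒰; p)` has `U_{v,j}`-eigenvalues which are
`p`-adic units in the intrinsic sense `x(U_{v,j})^{m!} → 1` (`1 ≤ j ≤ n-1`) — for `A = 𝒪_E`, `ℚ̄_p`
exactly `|x(U_{v,j})| = 1`.  When Hida's idempotent `e = lim_m U_p^{m!}` exists, a continuous point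
factors through `e 𝕋 = 𝕋^{S,ord}` iff it has slope zero at every `v ∣ p` (`x(e) = lim x(U_p)^{m!}`),
[cite: KhareThorne2017, §2.4, Lemma 2.10]; this equivalence is not formalised here. -/
def IsSlopeZeroAt {A : Type*} [CommRing A] [TopologicalSpace A] (x : HidaHeckeAlgebraGLn 𝒰 →+* A)
    (v : HeightOneSpectrum (𝓞 K)) : Prop :=
  ∀ j : ℕ, 1 ≤ j → j < n → Tendsto (fun m : ℕ => x (𝒰.hidaT v j) ^ m.factorial) atTop (𝓝 1)

end TameLevel

end BigHeckeGLn

/-! ### Hecke operators of normalising elements are translations; the diamond homomorphism -/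

namespace ArithmeticQuotient

section Normalising

variable (k : Type) [CommRing k] {Γ 𝒢 : Type} [Group Γ] [Group 𝒢] (ι : Γ →* 𝒢) (L : Subgroup 𝒢)
  (M : Type) [AddCommGroup M] [Module k M]

omit [Group Γ] in
variable {L} in
/-- If `g⁻¹ L g ⊆ L` then `L g L / L = {g L}` is a single coset. [folklore] -/
theorem doubleCosetQuot_eq_singleton_of_conj {g : 𝒢} (hg : ∀ l ∈ L, g⁻¹ * l * g ∈ L) :
    doubleCosetQuot L g = {(g : 𝒢 ⧸ L)} := by
  ext d
  simp only [Set.mem_singleton_iff, doubleCosetQuot]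
  constructor
  · rintro ⟨l, rfl⟩
    change ((l : 𝒢) • (g : 𝒢 ⧸ L)) = _
    rw [MulAction.Quotient.smul_coe, smul_eq_mul, QuotientGroup.eq]
    simpa [mul_assoc] using hg _ (L.inv_mem l.2)
  · rintro rfl
    exact MulAction.mem_orbit_self _

omit [Group Γ] in
variable {L} in
/-- For `g` with `g⁻¹ L g ⊆ L`, the Hecke operator `[L g L]` is right translation:
`(T_g f)(xL) = f(x g L)`. [folklore] -/
theorem heckeFun_apply_mk_of_conj {g : 𝒢} (hg : ∀ l ∈ L, g⁻¹ * l * g ∈ L) (f : (𝒢 ⧸ L) → M) (x : 𝒢) :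
    heckeFun k L g M f (x : 𝒢 ⧸ L) = f ((x * g : 𝒢) : 𝒢 ⧸ L) := by
  classical
  have hfin : (doubleCosetQuot L g).Finite := by
    rw [doubleCosetQuot_eq_singleton_of_conj hg]; exact Set.finite_singleton _
  have hset : hfin.toFinset = {(g : 𝒢 ⧸ L)} :=
    Finset.ext fun d => by rw [Set.Finite.mem_toFinset, doubleCosetQuot_eq_singleton_of_conj hg]; simp
  rw [heckeFun_apply_coe k L M g f x hfin, hset, Finset.sum_singleton, MulAction.Quotient.smul_coe,
    smul_eq_mul]

omit [Group Γ] in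
variable {L} in
/-- For `g, g'` with `g⁻¹ L g, g'⁻¹ L g' ⊆ L`: `T_{g g'} = T_g ∘ T_{g'}` on functions. [folklore] -/
theorem heckeFun_mul_of_conj {g g' : 𝒢} (hg : ∀ l ∈ L, g⁻¹ * l * g ∈ L)
    (hg' : ∀ l ∈ L, g'⁻¹ * l * g' ∈ L) :
    heckeFun k L (g * g') M = heckeFun k L g M ∘ₗ heckeFun k L g' M := by
  have hgg' : ∀ l ∈ L, (g * g')⁻¹ * l * (g * g') ∈ L := fun l hl => by
    have h := hg' _ (hg l hl)
    rwa [show g'⁻¹ * (g⁻¹ * l * g) * g' = (g * g')⁻¹ * l * (g * g') by group] at h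
  refine LinearMap.ext fun f => funext fun c => ?_
  induction c using QuotientGroup.induction_on with
  | H x =>
    rw [LinearMap.comp_apply, heckeFun_apply_mk_of_conj k M hgg', heckeFun_apply_mk_of_conj k M hg,
      heckeFun_apply_mk_of_conj k M hg', mul_assoc]

variable {L} in
/-- For `g, g'` with `g⁻¹ L g, g'⁻¹ L g' ⊆ L`: **`T_{g g'} = T_g T_{g'}` on `H^i(X_L, M)`** — the
Hecke operators of elements normalising the level (e.g. the diamond operators) are multiplicative.
[folklore] -/
theorem heckeEnd_mul_of_conj {g g' : 𝒢} (hg : ∀ l ∈ L, g⁻¹ * l * g ∈ L)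
    (hg' : ∀ l ∈ L, g'⁻¹ * l * g' ∈ L) (i : ℕ) :
    heckeEnd k L (g * g') M ι i = heckeEnd k L g M ι i * heckeEnd k L g' M ι i := by
  have hrep : heckeRepHom k L (g * g') M ι = heckeRepHom k L g' M ι ≫ heckeRepHom k L g M ι :=
    Rep.hom_ext (Representation.IntertwiningMap.ext (heckeFun_mul_of_conj k M hg hg'))
  rw [heckeEnd, heckeOperator, hrep, groupCohomology.map_id_comp, Module.End.mul_eq_comp, heckeEnd,
    heckeEnd, ModuleCat.hom_comp]

end Normalising

end ArithmeticQuotient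

namespace BigHeckeGLn

namespace TameLevel

variable {n : ℕ} {K : Type} [Field K] [NumberField K] {p : ℕ} [Fact p.Prime]
  (𝒰 : TameLevel n K p) (k : Type) [CommRing k]

/-- The Hecke families of elements `g, g'` preserving every Hida level under conjugation multiply:
`hidaFamily (g g') = hidaFamily g · hidaFamily g'`. [folklore] -/
theorem hidaFamily_mul_of_conj {g g' : FiniteAdelicGL n K}
    (hg : ∀ r x, x ∈ 𝒰.hidaLevel r → g⁻¹ * x * g ∈ 𝒰.hidaLevel r)
    (hg' : ∀ r x, x ∈ 𝒰.hidaLevel r → g'⁻¹ * x * g' ∈ 𝒰.hidaLevel r) :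
    𝒰.hidaFamily k (g * g') = 𝒰.hidaFamily k g * 𝒰.hidaFamily k g' :=
  funext fun x => ArithmeticQuotient.heckeEnd_mul_of_conj k (globalEmbedding n K) (modPow k (p : k) x.2.2)
    (fun l hl => hg x.2.1 l hl) (fun l hl => hg' x.2.1 l hl) x.1

/-- `hidaFamily 1 = 1` (`T_1 = [U(r)] = 1`). [folklore] -/
theorem hidaFamily_one : 𝒰.hidaFamily k 1 = 1 :=
  funext fun x => ArithmeticQuotient.heckeEnd_one k (globalEmbedding n K) (𝒰.hidaLevel x.2.1)
    (modPow k (p : k) x.2.2) x.1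

/-- **The diamond homomorphism `T_n(𝒪_v) →* 𝕋^S(𝒰; p)`**, `u ↦ ⟨u⟩_v` (`v ∣ p`, `U` maximal above
`p`): the group-like elements through which `𝕋^S(𝒰; p)` is an algebra over the group ring
`ℤ[T_n(𝒪_v)]` (and, by continuity, over the Iwasawa algebra `Λ_v = ℤ_p[[T_n(𝒪_v)]]`, not formalised)
[cite: AllenCalegariCaraianiGeeEtAl2023, §5.1] [cite: KhareThorne2017, §6.3 (Λ = 𝒪[[T(1)]])]. -/
def diamondHom (h𝒰 : 𝒰.IsMaximalAbove) {v : HeightOneSpectrum (𝓞 K)} (hv : (p : 𝓞 K) ∈ v.asIdeal) :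
    (Fin n → (v.adicCompletionIntegers K)ˣ) →* HidaHeckeAlgebraGLn 𝒰 where
  toFun u := 𝒰.hidaDiamond hv u
  map_one' := Subtype.ext (by
    change 𝒰.hidaFamily ℤ (diamondElement n K v 1) = 1
    rw [map_one, hidaFamily_one])
  map_mul' u u' := Subtype.ext (by
    change 𝒰.hidaFamily ℤ (diamondElement n K v (u * u')) = 𝒰.hidaFamily ℤ (diamondElement n K v u) *
      𝒰.hidaFamily ℤ (diamondElement n K v u')
    rw [map_mul]
    exact 𝒰.hidaFamily_mul_of_conj ℤ (fun r _ hx => diamondElement_conj_mem_hidaLevel h𝒰 hv u r hx)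
      fun r _ hx => diamondElement_conj_mem_hidaLevel h𝒰 hv u' r hx)

/-- Unfolding `diamondHom`. [folklore] -/
@[simp]
theorem diamondHom_apply (h𝒰 : 𝒰.IsMaximalAbove) {v : HeightOneSpectrum (𝓞 K)} (hv : (p : 𝓞 K) ∈ v.asIdeal)
    (u : Fin n → (v.adicCompletionIntegers K)ˣ) : 𝒰.diamondHom h𝒰 hv u = 𝒰.hidaDiamond hv u :=
  rfl

/-- **The diamond homomorphism into the ordinary Hecke algebra `T_n(𝒪_v) →* 𝕋^{S,ord}(𝒰)`.**
[cite: AllenCalegariCaraianiGeeEtAl2023, §5.1] -/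
def ordDiamondHom (h𝒰 : 𝒰.IsMaximalAbove) {v : HeightOneSpectrum (𝓞 K)} (hv : (p : 𝓞 K) ∈ v.asIdeal) :
    (Fin n → (v.adicCompletionIntegers K)ˣ) →* OrdinaryHeckeAlgebraGLn 𝒰 :=
  (𝒰.toOrd ℤ).toMonoidHom.comp (𝒰.diamondHom h𝒰 hv)

/-- Unfolding `ordDiamondHom`. [folklore] -/
@[simp]
theorem ordDiamondHom_apply (h𝒰 : 𝒰.IsMaximalAbove) {v : HeightOneSpectrum (𝓞 K)}
    (hv : (p : 𝓞 K) ∈ v.asIdeal) (u : Fin n → (v.adicCompletionIntegers K)ˣ) :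
    𝒰.ordDiamondHom h𝒰 hv u = 𝒰.ordDiamond hv u :=
  rfl

/-- **The `Λ_v`-algebra structure of `𝕋^{S,ord}(𝒰)`** at the level of the group ring: the algebra
homomorphism `ℤ[T_n(𝒪_v)] → 𝕋^{S,ord}(𝒰)` extending the diamond homomorphism (`MonoidAlgebra.lift`);
the Iwasawa algebra `𝒪[[T_n(𝒪_{K,p})]]` of [cite: AllenCalegariCaraianiGeeEtAl2023, §5.1] acts through
its completion. -/
def groupRingToOrd (h𝒰 : 𝒰.IsMaximalAbove) {v : HeightOneSpectrum (𝓞 K)} (hv : (p : 𝓞 K) ∈ v.asIdeal) :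
    MonoidAlgebra ℤ (Fin n → (v.adicCompletionIntegers K)ˣ) →ₐ[ℤ] OrdinaryHeckeAlgebraGLn 𝒰 :=
  MonoidAlgebra.lift ℤ (OrdinaryHeckeAlgebraGLn 𝒰) _ (𝒰.ordDiamondHom h𝒰 hv)

/-- `groupRingToOrd` on a group element is the diamond operator. [folklore] -/
theorem groupRingToOrd_of (h𝒰 : 𝒰.IsMaximalAbove) {v : HeightOneSpectrum (𝓞 K)}
    (hv : (p : 𝓞 K) ∈ v.asIdeal) (u : Fin n → (v.adicCompletionIntegers K)ˣ) :
    𝒰.groupRingToOrd h𝒰 hv (MonoidAlgebra.of ℤ _ u) = 𝒰.ordDiamond hv u := by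
  rw [groupRingToOrd, MonoidAlgebra.lift_of, ordDiamondHom_apply]

end TameLevel

end BigHeckeGLn

end Literature.NumberTheory.Automorphic
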